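import Mathlib.RingTheory.Polynomial.GaussLemma
import Mathlib.RingTheory.Localization.Integral
import Mathlib.FieldTheory.IsAlgClosed.Basic
import Mathlib.FieldTheory.Separable
import Mathlib.Algebra.MvPolynomial.NoZeroDivisors
import Mathlib.Algebra.MvPolynomial.Funext
import Mathlib.RingTheory.Polynomial.UniqueFactorization
import Mathlib.RingTheory.UniqueFactorizationDomain.Multiplicity
import Mathlib.Analysis.Complex.Polynomial.Basic
import Literature.Computability.AlgebraicComplexity.KaltofenFactorFromRoots
import Literature.Computability.AlgebraicComplexity.KaltofenFactorDescent
import Literature.Computability.AlgebraicComplexity.KaltofenFactorClosure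
import Literature.Computability.AlgebraicComplexity.ArithCircuitVars
import HarnessLib

/-!
# Kaltofen's theorem: factors of polynomials with small circuits have small circuits — PROVED
# over every field of characteristic zero (`KaltofenFactorBoundWith F 17`; `F` algebraically
# closed: `KaltofenFactorBoundWith F 12`)

Topic `Computability/AlgebraicComplexity`. E. Kaltofen, *Factorization of polynomials given by
straight-line programs* (1989); printed form P. Bürgisser, *Completeness classes in algebraic
complexity theory* (2024), Thm. 3.2: "Suppose the multivariate polynomial `f` of degree `d` over a
field of characteristic zero is computed by an arithmetic circuit of size `s`. Then any factor `g`
of `f` can be computed by an arithmetic circuit of size polynomially bounded in `s` and `d`." In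
the tree this is the NAMED FACT `KaltofenFactorBoundWith F κ` / `KaltofenFactorBound F`
(`KaltofenFactorClosure.lean`: `L(g) ≤ (L(f) + deg f + 2)^κ`, `L = complexity`, fan-in-two size
with free constants). Honest framing: a classical theorem (1989) formalised; nothing here bears on
`VP ≠ VNP`, which is NOT proved.

## Main results (0 named facts, 0 definitions; theorem-only)

* `kaltofenFactorBoundWith_of_isAlgClosed (F) [IsAlgClosed F] [CharZero F] :
  KaltofenFactorBoundWith F 12` — **Kaltofen's theorem with the explicit exponent `12` over every
  algebraically closed field of characteristic zero**;
  `kaltofenFactorBound_of_isAlgClosed : KaltofenFactorBound F`, and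
  `kaltofenFactorBound_complex : KaltofenFactorBound ℂ` (the summit field).
  This route uses the roots of the specialised factor as circuit constants, which live in the
  algebraic closure.
* `kaltofenFactorBoundWith_of_charZero (F) [CharZero F] : KaltofenFactorBoundWith F 17`,
  `kaltofenFactorBound_holds (F) [Field F] [CharZero F] : KaltofenFactorBound F` — **the named
  fact DISCHARGED for every field of characteristic zero** (exactly its hypotheses) — and
  `kaltofenFactorBound_rat : KaltofenFactorBound ℚ` (the field of
  `BIJL18PermanentZeroFactorClosureProofs.lean`). Sections `CoprimePoint`, `CoreCharZero`,
  `AssemblyCharZero`: the same pipeline, with the good point providing only COPRIMALITY of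
  `Pm(b; Y)` and `(Q ∂Pm)(b; Y)` (`KaltofenFactor.exists_coprimePoint`) and the engine replaced
  by the étale descent `KaltofenFactor.complexity_le_of_coprimeData` of
  `KaltofenFactorDescent.lean` (slow Newton iteration over `F[T]/(Pm(b; T))` from the generic
  root, characteristic polynomial of the iterate via the Hrubeš–Yehudayoff simulation and
  Berkowitz, identified with `∏_c (Y − z_c)` over the algebraic closure by Vandermonde
  conjugation) — still not Kaltofen's printed Hensel lifting (disclosed); fine forms
  `KaltofenFactor.complexity_le_of_irreducible_dvd_charZero`, `KaltofenFactor.complexity_le_of_dvd_charZero`.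
* `KaltofenFactor.complexity_le_of_irreducible_dvd` — the fine bound for ONE irreducible factor
  `p ∣ f` in `F[x_β]`: `L(p) ≤ (d+2)² (d (d ((d+2)² (L(f) + 2n + 4) + n + 2) + 2) + d + 1) + (d+1) + n`
  (`d = deg f`, `n = #β`).
* `KaltofenFactor.complexity_le_of_dvd` — every factor: `L(g) ≤ d · (that + 1) + 1` (unique
  factorisation: `g` is a unit times `≤ d` irreducible factors of `f`).
* Steps of independent use: `KaltofenFactor.natDegree_leadingCoeff_optionEquivLeft_shear`
  (transform to monic by the shear `x_b ↦ x_b + a_b y`, DSS Lemma 28),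
  `KaltofenFactor.prime_optionEquivLeft_shear`, `KaltofenFactor.exists_iterate_derivative_eq_mul`
  (differentiate `multiplicity − 1` times: the factor becomes simple, DSS proof of Thm. 1),
  `KaltofenFactor.exists_bezout_eq_C` / `KaltofenFactor.exists_goodPoint` (Bézout with cleared
  denominators via Gauss's lemma; a point where the specialised factor is separable and coprime to
  the cofactor, DSS Lemma 26 / Thm. 4).

## The proof (route: Bürgisser 2004 §3 and Dutta–Saxena–Sinhababu 2018 Thm. 4 "power series
complete split" / Cor. 5 / proof of Thm. 1 — NOT Kaltofen's printed Hensel lifting; disclosed)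

Let `p` be an irreducible factor of `f ≠ 0` in `F[x_β]`, `δ = deg p ≤ d = deg f`.
1. **Shear.** Choose `a ∈ F^β` with `p_δ(a) ≠ 0` (`p_δ` the top homogeneous component; `F` is
   infinite) and substitute `x_b ↦ x_b + a_b y` with a NEW variable `y`: in `F[x][y]` the image
   `P₁` of `p` has `y`-degree `δ` and the constant leading coefficient `p_δ(a)`
   (`natDegree_leadingCoeff_optionEquivLeft_shear`); cost `2 #β`; `p` is recovered by `y ↦ 0`
   (free). `P₁` is prime (the shear is an automorphism of `F[x, y]`).
2. **Simple factor.** With `Pm = P₁ / p_δ(a)` monic prime and `f₁` the image of `f`: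
   `f₁ = Pm^n Q₁`, `Pm ∤ Q₁` (`WfDvdMonoid.max_power_factor`), and `∂_y^{n-1} f₁ = Pm · Q` with
   `Pm ∤ Q` (characteristic zero: `Pm ∤ n Pm'`); cost `(d+2)² (L + 4)`
   (`RootLifting.complexity_optionEquivLeft_symm_iterate_derivative_le`).
3. **Good point.** Gauss's lemma (`Polynomial.Monic.irreducible_iff_irreducible_map_fraction_map`;
   `F[x]` is integrally closed as a UFD) makes `Pm` irreducible over `F(x)`, where it is coprime to
   `Q · Pm'`; clearing denominators (`IsLocalization.integerNormalization`) gives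
   `A Pm + B Q Pm' = w ≠ 0` in `F[x]`; at a point `b` with `w(b) ≠ 0` every root `c` of `Pm(b; y)`
   has `Q(b; c) ≠ 0 ≠ Pm'(b; c)`; so `Pm(b; y)` is separable with `δ` distinct roots (`F`
   algebraically closed), all simple roots of `(Pm Q)(b; y)`. Translate `x ↦ x + b` (cost `#β`).
4. **Roots and truncation** (`KaltofenFactorFromRoots.lean`): lift every root by `d` slow-Newton
   steps on `Pm Q` (cost `d (L(G) + 2)` each), `P₁ ≡ p_δ(a) ∏_c (y - z_c) (mod ⟨x⟩^{d+1})`, and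
   `P₁` (total degree `≤ d`) is the truncation of that product at degree `d` (BCS Lemma (21.25),
   cost factor `(d+2)²`). Translate back, set `y = 0`.
5. **All factors, no variable count.** `g ∣ f` is a unit times a sub-multiset of the irreducible
   factors of `f` (at most `d` of them, `MvPolynomial.uniqueFactorizationMonoid`); restricting to
   the `≤ 2 L(f) + 1` variables occurring in `f`
   (`ArithCircuit.card_vars_le_two_mul_complexity_add_one`; divisors involve no new variables,
   `degrees_mul_eq`) removes `#β`, and `d (B + 1) + 1 ≤ (L + d + 2)^{12}`.

Characteristic zero is used in step 2 (`n ≠ 0`, `Pm' ≠ 0`) and for infinitude; algebraic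
closedness in step 3 (roots of `Pm(b; y)` in `F`) — removed in the `CharZero` sections by the
étale descent of `KaltofenFactorDescent.lean` (exponent `17`). Constants are generous.

## References

* [Kaltofen1989] E. Kaltofen, *Factorization of polynomials given by straight-line programs*, in:
  Randomness and Computation (S. Micali, ed.), JAI Press 1989, 375–412.
* [Burgisser2024Completeness] P. Bürgisser, *Completeness classes in algebraic complexity theory*,
  arXiv:2406.06217, Thm. 3.2, Cor. 3.3.
* [Burgisser2004Factors] P. Bürgisser, *The complexity of factors of multivariate polynomials*,
  Found. Comput. Math. 4 (2004), §3.
* [DuttaSaxenaSinhababu2018] P. Dutta, N. Saxena, A. Sinhababu, *Discovering the roots: uniform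
  closure results for algebraic classes under factoring*, STOC 2018 = arXiv:1710.03214 (arXiv
  numbering): §1.3, Thm. 4 (power series complete split), Cor. 5, Lemma 26 (coprimality), Lemma 28
  (transform to monic), proof of Thm. 1 (differentiate `γᵢ − 1` times).
* [BurgisserClausenShokrollahi1997] Lemma (21.25).
-/

noncomputable section

namespace Literature.Computability.AlgebraicComplexity

open MvPolynomial Finset

namespace KaltofenFactor

/-! ### Linear substitutions and the shear `x_b ↦ x_b + a_b · y` -/

section Shear

variable {F : Type*} [Field F] {β : Type*}

/-- A substitution by polynomials of degree `≤ 1` does not raise the total degree. [folklore] -/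
private theorem totalDegree_aeval_le_of_linear {γ : Type*} {t : β → MvPolynomial γ F}
    (ht : ∀ b, (t b).totalDegree ≤ 1) (p : MvPolynomial β F) :
    (aeval t p).totalDegree ≤ p.totalDegree := by
  classical
  conv_lhs => rw [p.as_sum]
  rw [map_sum]
  refine totalDegree_finsetSum_le fun m hm => ?_
  rw [aeval_monomial, algebraMap_eq]
  refine (totalDegree_mul _ _).trans ?_
  rw [totalDegree_C, zero_add]
  simp only [Finsupp.prod]
  refine (totalDegree_finsetProd _ _).trans ?_
  calc ∑ i ∈ m.support, (t i ^ m i).totalDegree ≤ ∑ i ∈ m.support, m i := by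
        refine Finset.sum_le_sum fun i _ => (totalDegree_pow _ _).trans ?_
        calc m i * (t i).totalDegree ≤ m i * 1 := Nat.mul_le_mul_left _ (ht i)
          _ = m i := mul_one _
    _ ≤ p.totalDegree := by
        have := le_totalDegree hm
        simpa only [Finsupp.sum] using this

/-- Killing `y` undoes the shear: `p(x + a·y)|_{y = 0} = p`. [folklore] -/
private theorem aeval_kill_shear (a : β → F) (p : MvPolynomial β F) :
    aeval (fun o : Option β => o.elim (0 : MvPolynomial β F) X)
      (aeval (fun b : β => X (some b) + C (a b) * X none) p) = p := by
  have key : (aeval (fun o : Option β => o.elim (0 : MvPolynomial β F) X) :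
      MvPolynomial (Option β) F →ₐ[F] MvPolynomial β F).comp
        (aeval fun b : β => X (some b) + C (a b) * X none) = AlgHom.id F _ := by
    refine MvPolynomial.algHom_ext fun b => ?_
    simp only [AlgHom.comp_apply, aeval_X, map_add, map_mul, aeval_C, algebraMap_eq,
      Option.elim_some, Option.elim_none, mul_zero, add_zero, AlgHom.id_apply]
  exact AlgHom.congr_fun key p

/-- The shear does not raise the total degree. [folklore] -/
private theorem totalDegree_shear_le (a : β → F) (p : MvPolynomial β F) :
    (aeval (fun b : β => X (some b) + C (a b) * X none) p :
      MvPolynomial (Option β) F).totalDegree ≤ p.totalDegree := by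
  refine totalDegree_aeval_le_of_linear (fun b => ?_) p
  refine (totalDegree_add _ _).trans (max_le (totalDegree_X (R := F) (some b)).le ?_)
  refine (totalDegree_mul _ _).trans ?_
  rw [totalDegree_C, zero_add]
  exact (totalDegree_X (R := F) (none : Option β)).le

/-- Setting `x = 0` after the shear: `p(x + a·y)|_{x = 0} = p(a·y)` (coefficientwise `constantCoeff`
on `F[x][y]`). [folklore] -/
private theorem map_constantCoeff_optionEquivLeft_shear (a : β → F) (p : MvPolynomial β F) :
    (optionEquivLeft F β (aeval (fun b : β => X (some b) + C (a b) * X none) p)).map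
        (constantCoeff : MvPolynomial β F →+* F) =
      aeval (fun b : β => Polynomial.C (a b) * Polynomial.X) p := by
  have key : ((Polynomial.mapRingHom (constantCoeff : MvPolynomial β F →+* F)).comp
      (((optionEquivLeft F β : MvPolynomial (Option β) F ≃ₐ[F]
          Polynomial (MvPolynomial β F)) : MvPolynomial (Option β) F →+*
            Polynomial (MvPolynomial β F)).comp
        (aeval fun b : β => X (some b) + C (a b) * X none :
          MvPolynomial β F →ₐ[F] MvPolynomial (Option β) F).toRingHom)) =
      (aeval fun b : β => Polynomial.C (a b) * Polynomial.X :
        MvPolynomial β F →ₐ[F] Polynomial F).toRingHom := by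
    refine MvPolynomial.ringHom_ext (fun r => ?_) (fun b => ?_)
    · simp [optionEquivLeft_C, Polynomial.algebraMap_eq]
    · simp [optionEquivLeft_X_some, optionEquivLeft_X_none, optionEquivLeft_C]
  exact RingHom.congr_fun key p

/-- The `y^k`-coefficient of `p(a·y)` is the value at `a` of the degree-`k` homogeneous component
of `p`. [folklore] -/
private theorem coeff_aeval_C_mul_X (a : β → F) (p : MvPolynomial β F) (k : ℕ) :
    (aeval (fun b : β => Polynomial.C (a b) * Polynomial.X) p).coeff k =
      eval a (homogeneousComponent k p) := by
  classical
  have hmon : ∀ (m : β →₀ ℕ) (c : F),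
      aeval (fun b : β => Polynomial.C (a b) * Polynomial.X) (monomial m c) =
        Polynomial.C (c * m.prod fun b e => a b ^ e) * Polynomial.X ^ m.degree := by
    intro m c
    rw [aeval_monomial, Polynomial.algebraMap_eq, map_mul, mul_assoc]
    congr 1
    simp only [Finsupp.prod, mul_pow, ← map_pow, Finset.prod_mul_distrib, ← map_prod,
      Finset.prod_pow_eq_pow_sum]
    rfl
  conv_lhs => rw [p.as_sum, map_sum]
  rw [homogeneousComponent_apply, map_sum, Polynomial.finsetSum_coeff]
  simp_rw [hmon, Polynomial.coeff_C_mul_X_pow]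
  rw [Finset.sum_ite, Finset.sum_const_zero, add_zero]
  refine Finset.sum_congr ?_ fun m _ => ?_
  · ext m; simp only [Finset.mem_filter, eq_comm]
  · rw [eval_monomial]

/-- **Transform to monic** (Dutta–Saxena–Sinhababu 2018, Lemma 28 "transform to monic"; Kaltofen
1989): after the shear `x_b ↦ x_b + a_b y`, `p` read in `F[x][y]` has `y`-degree `deg p` and the
CONSTANT leading coefficient `p_{deg p}(a)` (the top homogeneous component at `a`), provided
`p_{deg p}(a) ≠ 0`. [cite: DuttaSaxenaSinhababu2018, Lemma 28 (transform to monic)] -/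
theorem natDegree_leadingCoeff_optionEquivLeft_shear (a : β → F) (p : MvPolynomial β F)
    (ha : eval a (homogeneousComponent p.totalDegree p) ≠ 0) :
    (optionEquivLeft F β (aeval (fun b : β => X (some b) + C (a b) * X none) p)).natDegree =
        p.totalDegree ∧
      (optionEquivLeft F β
        (aeval (fun b : β => X (some b) + C (a b) * X none) p)).leadingCoeff =
          C (eval a (homogeneousComponent p.totalDegree p)) := by
  set Ph : MvPolynomial (Option β) F :=
    aeval (fun b : β => X (some b) + C (a b) * X none) p with hPh
  set P₁ := optionEquivLeft F β Ph with hP₁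
  set δ := p.totalDegree with hδ
  have htot : Ph.totalDegree ≤ δ := totalDegree_shear_le a p
  have hnat_le : P₁.natDegree ≤ δ := by
    rw [hP₁, natDegree_optionEquivLeft]
    exact (degreeOf_le_totalDegree Ph none).trans htot
  -- the constant term of the `y^δ`-coefficient is `p_δ(a)`
  have hcc : constantCoeff (P₁.coeff δ) = eval a (homogeneousComponent δ p) := by
    rw [← Polynomial.coeff_map, hP₁, hPh, map_constantCoeff_optionEquivLeft_shear,
      coeff_aeval_C_mul_X]
  have hne : P₁.coeff δ ≠ 0 := fun h => ha (by rw [← hcc, h, map_zero])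
  -- hence that coefficient is a constant
  have hconst : P₁.coeff δ = C (eval a (homogeneousComponent δ p)) := by
    have hδle : δ ≤ Ph.totalDegree := by
      by_contra hlt
      push Not at hlt
      refine hne (Polynomial.coeff_eq_zero_of_natDegree_lt ?_)
      rw [hP₁, natDegree_optionEquivLeft]
      exact lt_of_le_of_lt (degreeOf_le_totalDegree Ph none) hlt
    have h0 : (P₁.coeff δ).totalDegree = 0 := by
      have := totalDegree_coeff_optionEquivLeft_add_le (R := F) (S₁ := β) Ph δ hδle
      rw [← hP₁] at this
      omega
    rw [totalDegree_eq_zero_iff_eq_C] at h0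
    rw [h0, ← constantCoeff_eq, hcc]
  have hnat : P₁.natDegree = δ :=
    le_antisymm hnat_le (Polynomial.le_natDegree_of_ne_zero hne)
  refine ⟨hnat, ?_⟩
  rw [Polynomial.leadingCoeff, hnat, hconst]

/-- `optionEquivLeft` sends `rename some u` to the constant `C u`. [folklore] -/
private theorem optionEquivLeft_rename_some (u : MvPolynomial β F) :
    optionEquivLeft F β (rename some u) = Polynomial.C u := by
  have key : ((optionEquivLeft F β : MvPolynomial (Option β) F ≃ₐ[F]
      Polynomial (MvPolynomial β F)) : MvPolynomial (Option β) F →+*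
        Polynomial (MvPolynomial β F)).comp
        (rename some : MvPolynomial β F →ₐ[F] MvPolynomial (Option β) F) = Polynomial.C := by
    refine MvPolynomial.ringHom_ext (fun r => ?_) (fun b => ?_)
    · simp [optionEquivLeft_C]
    · simp [optionEquivLeft_X_some]
  exact RingHom.congr_fun key u

/-- The shear is the automorphism `x_b ↦ x_b + a_b y, y ↦ y` of `F[x, y]` after `rename some`.
[folklore] -/
private theorem shear_eq_aeval_rename (a : β → F) (p : MvPolynomial β F) :
    aeval (fun b : β => X (some b) + C (a b) * X none) p =
      aeval (fun o : Option β => o.elim (X none) fun b => X (some b) + C (a b) * X none)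
        (rename some p : MvPolynomial (Option β) F) := by
  rw [aeval_rename]
  rfl

/-- The inverse shears compose to the identity. [folklore] -/
private theorem aeval_shear_aeval_shear_neg (a : β → F) (q : MvPolynomial (Option β) F) :
    aeval (fun o : Option β => o.elim (X none) fun b => X (some b) + C (a b) * X none)
      (aeval (fun o : Option β => o.elim (X none) fun b => X (some b) + C (-a b) * X none) q) =
        q := by
  have key : (aeval (fun o : Option β => o.elim (X none) fun b => X (some b) + C (a b) * X none) :
      MvPolynomial (Option β) F →ₐ[F] MvPolynomial (Option β) F).comp
        (aeval fun o : Option β => o.elim (X none) fun b => X (some b) + C (-a b) * X none) =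
      AlgHom.id F _ := by
    refine MvPolynomial.algHom_ext fun o => ?_
    rcases o with _ | b
    · simp
    · simp only [AlgHom.comp_apply, aeval_X, Option.elim_some, map_add, map_mul, aeval_C,
        algebraMap_eq, Option.elim_none, AlgHom.id_apply, map_neg]
      ring
  exact AlgHom.congr_fun key q

/-- The inverse shears compose to the identity (other order). [folklore] -/
private theorem aeval_shear_neg_aeval_shear (a : β → F) (q : MvPolynomial (Option β) F) :
    aeval (fun o : Option β => o.elim (X none) fun b => X (some b) + C (-a b) * X none)
      (aeval (fun o : Option β => o.elim (X none) fun b => X (some b) + C (a b) * X none) q) =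
        q := by
  have key : (aeval (fun o : Option β => o.elim (X none) fun b => X (some b) + C (-a b) * X none) :
      MvPolynomial (Option β) F →ₐ[F] MvPolynomial (Option β) F).comp
        (aeval fun o : Option β => o.elim (X none) fun b => X (some b) + C (a b) * X none) =
      AlgHom.id F _ := by
    refine MvPolynomial.algHom_ext fun o => ?_
    rcases o with _ | b
    · simp
    · simp only [AlgHom.comp_apply, aeval_X, Option.elim_some, map_add, map_mul, aeval_C,
        algebraMap_eq, Option.elim_none, AlgHom.id_apply, map_neg]
      ring
  exact AlgHom.congr_fun key q

/-- **The sheared factor stays prime in `F[x][y]`** (the shear is an automorphism of `F[x, y]`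
and `F[x] ⊂ F[x][y]` preserves primes). [folklore] -/
private theorem prime_optionEquivLeft_shear (a : β → F) {p : MvPolynomial β F} (hp : Prime p) :
    Prime (optionEquivLeft F β (aeval (fun b : β => X (some b) + C (a b) * X none) p)) := by
  -- the shear automorphism of `F[x, y]`
  have hcomp₁ : (aeval (fun o : Option β => o.elim (X none) fun b => X (some b) + C (a b) * X none) :
      MvPolynomial (Option β) F →ₐ[F] MvPolynomial (Option β) F).comp
        (aeval fun o : Option β => o.elim (X none) fun b => X (some b) + C (-a b) * X none) =
      AlgHom.id F _ := by
    refine MvPolynomial.algHom_ext fun o => ?_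
    rw [AlgHom.comp_apply, AlgHom.id_apply]
    exact aeval_shear_aeval_shear_neg a (X o)
  have hcomp₂ : (aeval (fun o : Option β => o.elim (X none) fun b => X (some b) + C (-a b) * X none) :
      MvPolynomial (Option β) F →ₐ[F] MvPolynomial (Option β) F).comp
        (aeval fun o : Option β => o.elim (X none) fun b => X (some b) + C (a b) * X none) =
      AlgHom.id F _ := by
    refine MvPolynomial.algHom_ext fun o => ?_
    rw [AlgHom.comp_apply, AlgHom.id_apply]
    exact aeval_shear_neg_aeval_shear a (X o)
  obtain ⟨T, hT⟩ : ∃ T : MvPolynomial (Option β) F ≃ₐ[F] MvPolynomial (Option β) F, ∀ q, T q =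
      aeval (fun o : Option β => o.elim (X none) fun b => X (some b) + C (a b) * X none) q :=
    ⟨AlgEquiv.ofAlgHom _ _ hcomp₁ hcomp₂, fun q => rfl⟩
  have h1 : Prime (rename some p : MvPolynomial (Option β) F) := by
    have : Prime (optionEquivLeft F β (rename some p)) := by
      rw [optionEquivLeft_rename_some]; exact Polynomial.prime_C_iff.2 hp
    exact (MulEquiv.prime_iff (optionEquivLeft F β)).1 this
  have h2 : Prime (T (rename some p)) := (MulEquiv.prime_iff T).2 h1
  rw [hT, ← shear_eq_aeval_rename] at h2
  exact (MulEquiv.prime_iff (optionEquivLeft F β)).2 h2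

end Shear

/-! ### Reduction to a simple factor: differentiate `(multiplicity - 1)` times -/

section Multiplicity

variable {F : Type*} [Field F] {β : Type*}

/-- `∂_Y (P^{m+1} Q) = P^m ((m+1) P' Q + P Q')`. [folklore] -/
private theorem derivative_pow_succ_mul (P Q : Polynomial (MvPolynomial β F)) (m : ℕ) :
    Polynomial.derivative (P ^ (m + 1) * Q) =
      P ^ m * (Polynomial.C ((m + 1 : ℕ) : MvPolynomial β F) * Polynomial.derivative P * Q +
        P * Polynomial.derivative Q) := by
  rw [Polynomial.derivative_mul, Polynomial.derivative_pow_succ]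
  push_cast
  ring

variable [CharZero F]

/-- **Making the factor simple** (Kaltofen 1989; Dutta–Saxena–Sinhababu 2018, proof of Thm. 1:
"we differentiate `f̃` wrt `y`, `(γ_i - 1)` many times, so that the multiplicity of the root we want
to recover becomes exactly one"): if the prime `P` of positive `Y`-degree divides `f₁ ≠ 0` in
`F[x][Y]` (characteristic zero), then some iterated `Y`-derivative of `f₁` is `P · Q` with
`P ∤ Q`. (If `f₁ = P^n Q₁`, `P ∤ Q₁`, then `∂_Y^{n-1} f₁ = P · Q` with `P ∤ Q`, because `P ∤ n P'`.)
[cite: DuttaSaxenaSinhababu2018, proof of Thm. 1 (differentiate γᵢ − 1 times)] -/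
theorem exists_iterate_derivative_eq_mul {f₁ P : Polynomial (MvPolynomial β F)} (hf : f₁ ≠ 0)
    (hP : Prime P) (hdvd : P ∣ f₁) (hdeg : P.natDegree ≠ 0) :
    ∃ (k : ℕ) (Q : Polynomial (MvPolynomial β F)),
      Polynomial.derivative^[k] f₁ = P * Q ∧ ¬ P ∣ Q := by
  obtain ⟨n, Q₁, hndvd, hf₁⟩ := WfDvdMonoid.max_power_factor hf hP.irreducible
  have hn : n ≠ 0 := by
    rintro rfl
    rw [pow_zero, one_mul] at hf₁
    exact hndvd (hf₁ ▸ hdvd)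
  -- `P ∤ P'` (degree) and `P ∤ m` for `m ≠ 0` (a unit in characteristic zero)
  have hP' : ¬ P ∣ Polynomial.derivative P := by
    intro h
    have hne : Polynomial.derivative P ≠ 0 := Polynomial.derivative_ne_zero.2 hdeg
    exact absurd (Polynomial.natDegree_le_of_dvd h hne)
      (not_le.2 (Polynomial.natDegree_derivative_lt hdeg))
  have hunit : ∀ m : ℕ, IsUnit (Polynomial.C ((m + 1 : ℕ) : MvPolynomial β F)) := fun m => by
    rw [← map_natCast (C : F →+* MvPolynomial β F)]
    exact Polynomial.isUnit_C.2
      ((isUnit_iff_ne_zero.2 (by exact_mod_cast Nat.succ_ne_zero m)).map C)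
  -- the inductive claim `∂^k f₁ = P^{n-k} Q_k`, `P ∤ Q_k`, for `k < n`
  have key : ∀ k, k < n → ∃ Q, Polynomial.derivative^[k] f₁ = P ^ (n - k) * Q ∧ ¬ P ∣ Q := by
    intro k
    induction k with
    | zero =>
      intro _
      exact ⟨Q₁, by rw [Function.iterate_zero_apply, Nat.sub_zero, hf₁], hndvd⟩
    | succ k ih =>
      intro hk
      obtain ⟨Q, hQ, hQn⟩ := ih (Nat.lt_of_succ_lt hk)
      obtain ⟨m, hm⟩ : ∃ m, n - k = m + 1 + 1 := ⟨n - k - 2, by omega⟩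
      refine ⟨Polynomial.C ((m + 1 + 1 : ℕ) : MvPolynomial β F) * Polynomial.derivative P * Q +
        P * Polynomial.derivative Q, ?_, ?_⟩
      · rw [Function.iterate_succ_apply', hQ, hm, show n - (k + 1) = m + 1 by omega,
          derivative_pow_succ_mul]
      · intro hdiv
        have h1 : P ∣ Polynomial.C ((m + 1 + 1 : ℕ) : MvPolynomial β F) *
            Polynomial.derivative P * Q := by
          have := dvd_sub hdiv (dvd_mul_right P (Polynomial.derivative Q))
          rwa [add_sub_cancel_right] at this
        rcases hP.dvd_or_dvd h1 with h2 | h2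
        · rcases hP.dvd_or_dvd h2 with h3 | h3
          · exact hP.not_unit (isUnit_of_dvd_unit h3 (hunit (m + 1)))
          · exact hP' h3
        · exact hQn h2
  obtain ⟨Q, hQ, hQn⟩ := key (n - 1) (by omega)
  exact ⟨n - 1, Q, by rw [hQ, show n - (n - 1) = 1 by omega, pow_one], hQn⟩

end Multiplicity

/-! ### A good expansion point: Bézout with cleared denominators -/

section GoodPoint

variable {F : Type*} [Field F] {β : Type*}

/-- **Bézout with a nonzero constant right-hand side.** If `Pm ∈ F[x][Y]` is monic irreducible and
does not divide `T`, then `A · Pm + B · T = w` for some `A, B ∈ F[x][Y]` and `0 ≠ w ∈ F[x]`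
(Gauss's lemma: `Pm` stays irreducible over `F(x)`, where it is then coprime to `T`; clear
denominators). This is the resultant-free form of "`Res_Y(Pm, T) ≠ 0`" (Dutta–Saxena–Sinhababu
2018, Prop. 2 "Res vs gcd" and Lemma 26 "coprimality"). [cite: DuttaSaxenaSinhababu2018, Prop. 2 and Lemma 26 (arXiv numbering)] -/
theorem exists_bezout_eq_C {Pm T : Polynomial (MvPolynomial β F)} (hm : Pm.Monic)
    (hirr : Irreducible Pm) (hT : ¬ Pm ∣ T) :
    ∃ (A B : Polynomial (MvPolynomial β F)) (w : MvPolynomial β F),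
      w ≠ 0 ∧ A * Pm + B * T = Polynomial.C w := by
  classical
  set ι := algebraMap (MvPolynomial β F) (FractionRing (MvPolynomial β F)) with hι
  have hinj : Function.Injective ι := IsFractionRing.injective _ _
  have hirrK : Irreducible (Pm.map ι) :=
    (hm.irreducible_iff_irreducible_map_fraction_map).1 hirr
  have hndK : ¬ Pm.map ι ∣ T.map ι := by rwa [Polynomial.map_dvd_map ι hinj hm]
  obtain ⟨A', B', hAB⟩ := (hirrK.coprime_iff_not_dvd).2 hndK
  obtain ⟨u, hu, hA⟩ := IsLocalization.integerNormalization_spec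
    (nonZeroDivisors (MvPolynomial β F)) A'
  obtain ⟨v, hv, hB⟩ := IsLocalization.integerNormalization_spec
    (nonZeroDivisors (MvPolynomial β F)) B'
  rw [← hι] at hA hB
  refine ⟨Polynomial.C v * IsLocalization.integerNormalization (nonZeroDivisors _) A',
    Polynomial.C u * IsLocalization.integerNormalization (nonZeroDivisors _) B', u * v,
    mul_ne_zero (nonZeroDivisors.ne_zero hu) (nonZeroDivisors.ne_zero hv), ?_⟩
  apply Polynomial.map_injective ι hinj
  simp only [Polynomial.map_add, Polynomial.map_mul, Polynomial.map_C, hA, hB, map_mul]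
  rw [Algebra.smul_def, Algebra.smul_def, Polynomial.algebraMap_apply, Polynomial.algebraMap_apply,
    ← hι]
  linear_combination (Polynomial.C (ι u) * Polynomial.C (ι v)) * hAB

/-- **A good expansion point** (Dutta–Saxena–Sinhababu 2018, Lemma 26 "coprimality" /
Thm. 4: "`β̄` is random, so `f̃ᵢ(0̄, y)` and the cofactors stay coprime"): under the hypotheses of
`exists_bezout_eq_C`, over an infinite field there is a point `b` such that no root of `Pm(b; Y)`
is a root of `T(b; Y)`. [cite: DuttaSaxenaSinhababu2018, Lemma 26 and Thm. 4 (arXiv numbering)] -/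
theorem exists_goodPoint [Infinite F] {Pm T : Polynomial (MvPolynomial β F)} (hm : Pm.Monic)
    (hirr : Irreducible Pm) (hT : ¬ Pm ∣ T) :
    ∃ b : β → F, ∀ c : F, (Pm.map (eval b)).IsRoot c → (T.map (eval b)).eval c ≠ 0 := by
  obtain ⟨A, B, w, hw, hAB⟩ := exists_bezout_eq_C hm hirr hT
  obtain ⟨b, hb⟩ : ∃ b : β → F, eval b w ≠ 0 := by
    by_contra h
    push Not at h
    exact hw (MvPolynomial.funext fun x => by rw [h x, map_zero])
  refine ⟨b, fun c hc hT0 => hb ?_⟩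
  have := congrArg (fun q : Polynomial (MvPolynomial β F) => (q.map (eval b)).eval c) hAB
  simp only [Polynomial.map_add, Polynomial.map_mul, Polynomial.map_C, Polynomial.eval_add,
    Polynomial.eval_mul, Polynomial.eval_C, hc.eq_zero, hT0, mul_zero, zero_add] at this
  exact this.symm

end GoodPoint

/-! ### Translations `x ↦ x + b` (as in `RootLifting`) -/

section Translate

variable {F : Type*} [Field F] {β : Type*}

/-- Translating the `x`-variables acts on `F[x][y]` coefficientwise. [folklore] -/
private theorem optionEquivLeft_aeval_translate (b : β → F) (G : MvPolynomial (Option β) F) :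
    optionEquivLeft F β
        (aeval (fun o : Option β => o.elim (X none) fun b' => X (some b') + C (b b')) G) =
      Polynomial.map ((aeval fun b' : β => X b' + C (b b') :
        MvPolynomial β F →ₐ[F] MvPolynomial β F) : MvPolynomial β F →+* MvPolynomial β F)
        (optionEquivLeft F β G) := by
  have key : ((optionEquivLeft F β : MvPolynomial (Option β) F ≃ₐ[F]
      Polynomial (MvPolynomial β F)) : MvPolynomial (Option β) F →+*
        Polynomial (MvPolynomial β F)).comp
        (aeval fun o : Option β => o.elim (X none) fun b' => X (some b') + C (b b') :
          MvPolynomial (Option β) F →ₐ[F] MvPolynomial (Option β) F).toRingHom =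
      (Polynomial.mapRingHom ((aeval fun b' : β => X b' + C (b b') :
        MvPolynomial β F →ₐ[F] MvPolynomial β F) : MvPolynomial β F →+* MvPolynomial β F)).comp
        ((optionEquivLeft F β : MvPolynomial (Option β) F ≃ₐ[F]
          Polynomial (MvPolynomial β F)) : MvPolynomial (Option β) F →+*
            Polynomial (MvPolynomial β F)) := by
    refine MvPolynomial.ringHom_ext (fun r => ?_) (fun o => ?_)
    · simp [optionEquivLeft_C]
    · rcases o with _ | b'
      · simp [optionEquivLeft_X_none]
      · simp [optionEquivLeft_X_some, optionEquivLeft_C]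
  exact RingHom.congr_fun key G

/-- The constant term after `x ↦ x + b` is the value at `b`. [folklore] -/
private theorem constantCoeff_comp_translate (b : β → F) :
    (constantCoeff : MvPolynomial β F →+* F).comp
        ((aeval fun b' : β => X b' + C (b b') :
          MvPolynomial β F →ₐ[F] MvPolynomial β F) : MvPolynomial β F →+* MvPolynomial β F) =
      eval b := by
  refine MvPolynomial.ringHom_ext (fun c => ?_) (fun b' => ?_)
  · simp
  · simp

/-- Translating back. [folklore] -/
private theorem aeval_translate_neg_translate (b : β → F) (q : MvPolynomial (Option β) F) :
    aeval (fun o : Option β => o.elim (X none) fun b' => X (some b') + C (-b b'))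
      (aeval (fun o : Option β => o.elim (X none) fun b' => X (some b') + C (b b')) q) = q := by
  have key : (aeval (fun o : Option β => o.elim (X none) fun b' => X (some b') + C (-b b')) :
      MvPolynomial (Option β) F →ₐ[F] MvPolynomial (Option β) F).comp
        (aeval fun o : Option β => o.elim (X none) fun b' => X (some b') + C (b b')) =
      AlgHom.id F _ := by
    refine MvPolynomial.algHom_ext fun o => ?_
    rcases o with _ | b'
    · simp
    · simp only [AlgHom.comp_apply, aeval_X, Option.elim_some, map_add, aeval_C, algebraMap_eq,
        AlgHom.id_apply, map_neg, add_assoc, neg_add_cancel, add_zero]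
  exact AlgHom.congr_fun key q

/-- Translations do not raise the total degree. [folklore] -/
private theorem totalDegree_translate_le (b : β → F) (q : MvPolynomial (Option β) F) :
    (aeval (fun o : Option β => o.elim (X none) fun b' => X (some b') + C (b b')) q).totalDegree
      ≤ q.totalDegree := by
  refine totalDegree_aeval_le_of_linear (fun o => ?_) q
  rcases o with _ | b'
  · exact (totalDegree_X (R := F) (none : Option β)).le
  · refine (totalDegree_add _ _).trans (max_le (totalDegree_X (R := F) (some b')).le ?_)
    rw [totalDegree_C]; exact Nat.zero_le _

variable [Fintype β]

/-- A translation costs `≤ #β` gates. [folklore] -/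
private theorem complexity_translate_le (b : β → F) (q : MvPolynomial (Option β) F) :
    complexity (aeval (fun o : Option β => o.elim (X none) fun b' => X (some b') + C (b b')) q)
      ≤ complexity q + Fintype.card β := by
  classical
  calc complexity (aeval (fun o : Option β => o.elim (X none) fun b' => X (some b') + C (b b')) q)
      ≤ complexity q + ∑ o : Option β, complexity ((fun o : Option β =>
          o.elim (X none) fun b' => X (some b') + C (b b')) o) := complexity_aeval_le _ _
    _ ≤ complexity q + ∑ _b' : β, 1 := by
        gcongr
        rw [Fintype.sum_option]
        simp only [Option.elim_none, Option.elim_some]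
        rw [complexity_X_holds, zero_add]
        refine Finset.sum_le_sum fun b' _ => ?_
        calc complexity (X (some b') + C (b b') : MvPolynomial (Option β) F)
            ≤ complexity (X (some b') : MvPolynomial (Option β) F) +
                complexity (C (b b') : MvPolynomial (Option β) F) + 1 := complexity_add_le_holds _ _
          _ = 1 := by rw [complexity_X_holds, complexity_C_holds]
    _ = complexity q + Fintype.card β := by rw [sum_const, card_univ, smul_eq_mul, mul_one]

/-- The shear costs `≤ 2 #β` gates. [folklore] -/
private theorem complexity_shear_le (a : β → F) (q : MvPolynomial β F) :
    complexity (aeval (fun b : β => X (some b) + C (a b) * X none) q : MvPolynomial (Option β) F)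
      ≤ complexity q + 2 * Fintype.card β := by
  classical
  calc complexity (aeval (fun b : β => X (some b) + C (a b) * X none) q :
        MvPolynomial (Option β) F)
      ≤ complexity q + ∑ b : β, complexity (X (some b) + C (a b) * X none :
          MvPolynomial (Option β) F) := complexity_aeval_le _ _
    _ ≤ complexity q + ∑ _b : β, 2 := by
        gcongr with b
        calc complexity (X (some b) + C (a b) * X none : MvPolynomial (Option β) F)
            ≤ complexity (X (some b) : MvPolynomial (Option β) F) +
                complexity (C (a b) * X none : MvPolynomial (Option β) F) + 1 :=
              complexity_add_le_holds _ _
          _ ≤ 0 + (complexity (C (a b) : MvPolynomial (Option β) F) +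
                complexity (X none : MvPolynomial (Option β) F) + 1) + 1 := by
              gcongr
              · exact (complexity_X_holds _).le
              · exact complexity_mul_le_holds _ _
          _ = 2 := by rw [complexity_X_holds, complexity_C_holds]
    _ = complexity q + 2 * Fintype.card β := by
        rw [sum_const, card_univ, smul_eq_mul, mul_comm]

/-- Killing `y` is free. [folklore] -/
private theorem complexity_kill_le (q : MvPolynomial (Option β) F) :
    complexity (aeval (fun o : Option β => o.elim (0 : MvPolynomial β F) X) q) ≤ complexity q := by
  classical
  calc complexity (aeval (fun o : Option β => o.elim (0 : MvPolynomial β F) X) q)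
      ≤ complexity q + ∑ o : Option β,
          complexity ((fun o : Option β => o.elim (0 : MvPolynomial β F) X) o) :=
        complexity_aeval_le _ _
    _ = complexity q := by
        rw [Fintype.sum_option]
        simp only [Option.elim_none, Option.elim_some]
        have h0 : complexity (0 : MvPolynomial β F) = 0 := by rw [← C_0, complexity_C_holds]
        rw [h0, zero_add, Finset.sum_eq_zero fun b _ => complexity_X_holds (k := F) b, add_zero]

end Translate

/-! ### The core: an irreducible factor of `f` has small circuits -/

section Core

variable {F : Type*} [Field F] {β : Type*}

/-- The top homogeneous component of a nonzero polynomial is nonzero. [folklore] -/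
private theorem homogeneousComponent_totalDegree_ne_zero {p : MvPolynomial β F} (hp : p ≠ 0) :
    homogeneousComponent p.totalDegree p ≠ 0 := by
  classical
  obtain ⟨m, hm, hmax⟩ := Finset.exists_mem_eq_sup p.support
    (MvPolynomial.support_nonempty.2 hp) (fun s : β →₀ ℕ => s.sum fun _ e => e)
  have hdeg : m.degree = p.totalDegree := by
    rw [MvPolynomial.totalDegree, hmax, Finsupp.degree_apply]
    rfl
  intro h
  have := congrArg (coeff m) h
  rw [coeff_homogeneousComponent, if_pos hdeg, coeff_zero] at this
  exact (mem_support_iff.1 hm) this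

/-- `(P.map τ)(C c)(0) = P(b; c)` for the translation `τ : x ↦ x + b`. [folklore] -/
private theorem coeff_zero_eval_C_map_translate (b : β → F) (P : Polynomial (MvPolynomial β F))
    (c : F) :
    coeff 0 ((P.map ((aeval fun b' : β => X b' + C (b b') :
        MvPolynomial β F →ₐ[F] MvPolynomial β F) : MvPolynomial β F →+* MvPolynomial β F)).eval
          (C c)) = (P.map (eval b)).eval c := by
  rw [coeff_zero_eval_C, Polynomial.map_map, constantCoeff_comp_translate]

variable [IsAlgClosed F] [CharZero F] [Fintype β]

/-- **Kaltofen's theorem for one irreducible factor (fine form).** Over an algebraically closed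
field of characteristic zero: if `p` is irreducible and divides `f ≠ 0` in `F[x_β]`, then
`L(p) ≤ (d+2)² (d (d ((d+2)² (L(f) + 2n + 4) + n + 2) + 2) + d + 1) + (d+1) + n`, where
`d = deg f`, `n = #β`, `L = complexity`. Route (Dutta–Saxena–Sinhababu 2018 Thm. 4 / Cor. 5 and
proof of Thm. 1; Bürgisser 2004 §3): shear `x ↦ x + a y` making `p` monic in the new variable `y`
(Lemma 28), differentiate `(multiplicity - 1)` times in `y` (`RootLifting`: cost `(d+2)²(L+4)`),
translate to a point where the roots of `p(b; y)` are simple roots off the cofactor (Lemma 26),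
lift all `deg p` roots by slow Newton iteration and truncate the product
(`KaltofenFactor.complexity_le_of_rootData`), translate back, set `y = 0`.
[cite: DuttaSaxenaSinhababu2018, Thm. 4, Cor. 5 and proof of Thm. 1; Burgisser2024Completeness, Thm. 3.2] -/
theorem complexity_le_of_irreducible_dvd (f p : MvPolynomial β F) (hf : f ≠ 0)
    (hp : Irreducible p) (hdvd : p ∣ f) :
    complexity p ≤
      (f.totalDegree + 2) ^ 2 * (f.totalDegree * (f.totalDegree *
          ((f.totalDegree + 2) ^ 2 * (complexity f + 2 * Fintype.card β + 4) + Fintype.card β + 2)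
          + 2) + f.totalDegree + 1) + (f.totalDegree + 1) + Fintype.card β := by
  classical
  -- degrees
  have hp0 : p ≠ 0 := hp.ne_zero
  have hδd : p.totalDegree ≤ f.totalDegree := totalDegree_le_of_dvd_of_isDomain hdvd hf
  have hδpos : 0 < p.totalDegree := by
    rw [Nat.pos_iff_ne_zero]
    intro h0
    rw [totalDegree_eq_zero_iff_eq_C] at h0
    refine hp.not_isUnit ?_
    rw [h0]
    refine (isUnit_iff_ne_zero.2 fun hc => hp0 ?_).map C
    rw [h0, hc, C_0]
  -- Step 1: a direction `a` with `p_δ(a) ≠ 0`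
  obtain ⟨a, ha⟩ : ∃ a : β → F, eval a (homogeneousComponent p.totalDegree p) ≠ 0 := by
    by_contra h
    push Not at h
    exact homogeneousComponent_totalDegree_ne_zero hp0
      (MvPolynomial.funext fun x => by rw [h x, map_zero])
  -- Step 2: the shear
  set Ph₀ : MvPolynomial (Option β) F :=
    aeval (fun b : β => X (some b) + C (a b) * X none) p with hPh₀
  set fh : MvPolynomial (Option β) F :=
    aeval (fun b : β => X (some b) + C (a b) * X none) f with hfh
  set a₀ : F := eval a (homogeneousComponent p.totalDegree p) with ha₀
  set P₁ : Polynomial (MvPolynomial β F) := optionEquivLeft F β Ph₀ with hP₁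
  obtain ⟨hnat, hlc⟩ := natDegree_leadingCoeff_optionEquivLeft_shear a p ha
  rw [← hPh₀, ← hP₁] at hnat hlc
  set Pm : Polynomial (MvPolynomial β F) := Polynomial.C (C a₀⁻¹) * P₁ with hPm
  have hCC : Polynomial.C (C a₀) * Polynomial.C (C a₀⁻¹) =
      (1 : Polynomial (MvPolynomial β F)) := by
    rw [← Polynomial.C_mul, ← C_mul, mul_inv_cancel₀ ha, C_1, Polynomial.C_1]
  have hP₁eq : P₁ = Polynomial.C (C a₀) * Pm := by
    rw [hPm, ← mul_assoc, hCC, one_mul]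
  have hPm_monic : Pm.Monic := by
    refine Polynomial.monic_C_mul_of_mul_leadingCoeff_eq_one ?_
    rw [hlc, ← C_mul, inv_mul_cancel₀ ha, C_1]
  have hPm_natDegree : Pm.natDegree = p.totalDegree := by
    rw [hPm, Polynomial.natDegree_C_mul (C_ne_zero.2 (inv_ne_zero ha))]
    exact hnat
  have hPm_deg0 : Pm.natDegree ≠ 0 := by rw [hPm_natDegree]; exact hδpos.ne'
  have hPm_prime : Prime Pm := by
    have h := prime_optionEquivLeft_shear a (UniqueFactorizationMonoid.irreducible_iff_prime.1 hp)
    rw [← hPh₀, ← hP₁] at h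
    obtain ⟨u, hu⟩ := Polynomial.isUnit_C.2
      ((isUnit_iff_ne_zero.2 (inv_ne_zero ha)).map (C : F →+* MvPolynomial β F))
    refine Associated.prime ⟨u, ?_⟩ h
    rw [hPm, hu, mul_comm]
  -- Step 3: multiplicity reduction
  have hfh0 : fh ≠ 0 := by
    intro h
    apply hf
    rw [← aeval_kill_shear a f, ← hfh, h, map_zero]
  set f₁ : Polynomial (MvPolynomial β F) := optionEquivLeft F β fh with hf₁
  have hf₁0 : f₁ ≠ 0 := by
    rw [hf₁]; exact (EmbeddingLike.map_ne_zero_iff).2 hfh0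
  have hPm_dvd : Pm ∣ f₁ := by
    obtain ⟨h, hfeq⟩ := hdvd
    refine ⟨Polynomial.C (C a₀) * optionEquivLeft F β
      (aeval (fun b : β => X (some b) + C (a b) * X none) h), ?_⟩
    rw [hf₁, hfh, hfeq, map_mul, map_mul, ← hPh₀, ← hP₁, hP₁eq]
    ring
  obtain ⟨k, Q, hψ, hQ⟩ := exists_iterate_derivative_eq_mul hf₁0 hPm_prime hPm_dvd hPm_deg0
  -- Step 4: a good expansion point
  have hT : ¬ Pm ∣ Q * Polynomial.derivative Pm := by
    intro h
    rcases hPm_prime.dvd_or_dvd h with h1 | h1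
    · exact hQ h1
    · have hne : Polynomial.derivative Pm ≠ 0 := Polynomial.derivative_ne_zero.2 hPm_deg0
      exact absurd (Polynomial.natDegree_le_of_dvd h1 hne)
        (not_le.2 (Polynomial.natDegree_derivative_lt hPm_deg0))
  obtain ⟨b, hb⟩ := exists_goodPoint hPm_monic hPm_prime.irreducible hT
  -- Step 5: translate by `b`
  set θ : Option β → MvPolynomial (Option β) F :=
    fun o => o.elim (X none) fun b' => X (some b') + C (b b') with hθ
  set τ : MvPolynomial β F →+* MvPolynomial β F :=
    ((aeval fun b' : β => X b' + C (b b') : MvPolynomial β F →ₐ[F] MvPolynomial β F) :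
      MvPolynomial β F →+* MvPolynomial β F) with hτ
  set G : MvPolynomial (Option β) F := aeval θ ((optionEquivLeft F β).symm
    (Polynomial.derivative^[k] f₁)) with hG
  set Ph : MvPolynomial (Option β) F := aeval θ Ph₀ with hPh
  have hτC : τ (C a₀) = C a₀ := by
    rw [hτ, AlgHom.coe_toRingHom, aeval_C, algebraMap_eq]
  have hEG : optionEquivLeft F β G = Polynomial.map τ (Polynomial.derivative^[k] f₁) := by
    rw [hG, hθ, hτ, optionEquivLeft_aeval_translate, AlgEquiv.apply_symm_apply]
  have hEPh : optionEquivLeft F β Ph = Polynomial.map τ P₁ := by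
    rw [hPh, hθ, hτ, optionEquivLeft_aeval_translate, ← hP₁]
  set P : Polynomial (MvPolynomial β F) := Pm.map τ with hPdef
  set Qt : Polynomial (MvPolynomial β F) := Q.map τ with hQt
  have hP_monic : P.Monic := hPm_monic.map τ
  have hP_natDegree : P.natDegree = p.totalDegree := by
    rw [hPdef, hPm_monic.natDegree_map]; exact hPm_natDegree
  have hEG' : optionEquivLeft F β G = P * Qt := by rw [hEG, hψ, Polynomial.map_mul]
  have hEPh' : optionEquivLeft F β Ph = Polynomial.C (C a₀) * P := by
    rw [hEPh, hP₁eq, Polynomial.map_mul, Polynomial.map_C, hτC]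
  -- root data at `b`
  set P₀ : Polynomial F := Pm.map (eval b) with hP₀
  have hP₀_monic : P₀.Monic := hPm_monic.map _
  have hP₀_natDegree : P₀.natDegree = p.totalDegree := by
    rw [hP₀, hPm_monic.natDegree_map]; exact hPm_natDegree
  have hP₀0 : P₀ ≠ 0 := hP₀_monic.ne_zero
  have hbQ : ∀ c : F, P₀.IsRoot c → (Q.map (eval b)).eval c ≠ 0 ∧
      ((Polynomial.derivative Pm).map (eval b)).eval c ≠ 0 := by
    intro c hc
    have h := hb c hc
    rw [Polynomial.map_mul, Polynomial.eval_mul] at h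
    exact ⟨left_ne_zero_of_mul h, right_ne_zero_of_mul h⟩
  have hsep : P₀.Separable := by
    rw [Polynomial.separable_def, Polynomial.isCoprime_iff_aeval_ne_zero_of_isAlgClosed (k := F) (K := F)]
    intro c
    rw [Polynomial.coe_aeval_eq_eval]
    by_cases hc : P₀.IsRoot c
    · right
      rw [hP₀, Polynomial.derivative_map]
      exact (hbQ c hc).2
    · left
      exact hc
  set S : Finset F := P₀.roots.toFinset with hS
  have hScard : S.card = P.natDegree := by
    rw [hS, Multiset.toFinset_card_of_nodup (Polynomial.nodup_roots hsep), hP_natDegree,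
      ← hP₀_natDegree]
    exact (IsAlgClosed.splits P₀).natDegree_eq_card_roots.symm
  have hSd : S.card ≤ f.totalDegree := by rw [hScard, hP_natDegree]; exact hδd
  have hmemS : ∀ c ∈ S, P₀.IsRoot c := fun c hc => by
    rw [hS, Multiset.mem_toFinset, Polynomial.mem_roots hP₀0] at hc
    exact hc
  have hroot : ∀ c ∈ S, coeff 0 (P.eval (C c)) = 0 := fun c hc => by
    rw [hPdef, hτ, coeff_zero_eval_C_map_translate, ← hP₀]
    exact (hmemS c hc).eq_zero
  have hQroot : ∀ c ∈ S, coeff 0 (Qt.eval (C c)) ≠ 0 := fun c hc => by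
    rw [hQt, hτ, coeff_zero_eval_C_map_translate]
    exact (hbQ c (hmemS c hc)).1
  have hP'root : ∀ c ∈ S, coeff 0 ((Polynomial.derivative P).eval (C c)) ≠ 0 := fun c hc => by
    rw [hPdef, Polynomial.derivative_map, hτ, coeff_zero_eval_C_map_translate]
    exact (hbQ c (hmemS c hc)).2
  have hPh_deg : Ph.totalDegree ≤ f.totalDegree :=
    (totalDegree_translate_le b Ph₀).trans ((totalDegree_shear_le a p).trans hδd)
  -- the engine
  have hcore := complexity_le_of_rootData G Ph a₀ P Qt hP_monic hEG' hEPh' S hScard hroot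
    hQroot hP'root hPh_deg
  -- the costs
  have hfh_deg : fh.degreeOf none ≤ f.totalDegree :=
    (degreeOf_le_totalDegree fh none).trans (totalDegree_shear_le a f)
  have hG_c : complexity G ≤ (f.totalDegree + 2) ^ 2 * (complexity f + 2 * Fintype.card β + 4) +
      Fintype.card β := by
    calc complexity G
        ≤ complexity ((optionEquivLeft F β).symm (Polynomial.derivative^[k] f₁)) +
            Fintype.card β := complexity_translate_le b _
      _ ≤ (f.totalDegree + 2) ^ 2 * (complexity fh + 4) + Fintype.card β := by
          gcongr
          rw [hf₁]
          exact complexity_optionEquivLeft_symm_iterate_derivative_le fh k hfh_deg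
      _ ≤ (f.totalDegree + 2) ^ 2 * (complexity f + 2 * Fintype.card β + 4) + Fintype.card β := by
          gcongr
          exact complexity_shear_le a f
  have hPh₀_c : complexity Ph₀ ≤ complexity Ph + Fintype.card β := by
    have h : aeval (fun o : Option β => o.elim (X none) fun b' => X (some b') + C ((fun b'' =>
        -b b'') b')) Ph = Ph₀ := by
      rw [hPh, hθ]
      exact aeval_translate_neg_translate b Ph₀
    calc complexity Ph₀ = complexity (aeval (fun o : Option β => o.elim (X none) fun b' =>
          X (some b') + C ((fun b'' => -b b'') b')) Ph) := by rw [h]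
      _ ≤ complexity Ph + Fintype.card β := complexity_translate_le (fun b'' => -b b'') Ph
  have hp_c : complexity p ≤ complexity Ph₀ := by
    have h : aeval (fun o : Option β => o.elim (0 : MvPolynomial β F) X) Ph₀ = p := by
      rw [hPh₀]; exact aeval_kill_shear a p
    calc complexity p
        = complexity (aeval (fun o : Option β => o.elim (0 : MvPolynomial β F) X) Ph₀) := by
          rw [h]
      _ ≤ complexity Ph₀ := complexity_kill_le Ph₀
  -- assembly
  calc complexity p ≤ complexity Ph₀ := hp_c
    _ ≤ complexity Ph + Fintype.card β := hPh₀_c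
    _ ≤ (f.totalDegree + 2) ^ 2 * (S.card * (f.totalDegree * (complexity G + 2) + 2) +
          S.card + 1) + (f.totalDegree + 1) + Fintype.card β := by gcongr
    _ ≤ (f.totalDegree + 2) ^ 2 * (f.totalDegree * (f.totalDegree *
          ((f.totalDegree + 2) ^ 2 * (complexity f + 2 * Fintype.card β + 4) + Fintype.card β + 2)
          + 2) + f.totalDegree + 1) + (f.totalDegree + 1) + Fintype.card β := by
        gcongr

end Core

/-! ### From irreducible factors to arbitrary factors, and removal of the variable count -/

section Assembly

variable {F : Type*} [Field F]

/-- Constants cost nothing. [folklore] -/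
private theorem complexity_eq_zero_of_totalDegree_eq_zero {σ : Type*} (g : MvPolynomial σ F)
    (h : g.totalDegree = 0) : complexity g = 0 := by
  rw [totalDegree_eq_zero_iff_eq_C] at h
  rw [h, complexity_C_holds]

/-- Units of `F[x]` cost nothing. [folklore] -/
private theorem complexity_eq_zero_of_isUnit {σ : Type*} {u : MvPolynomial σ F} (hu : IsUnit u) :
    complexity u = 0 := by
  obtain ⟨r, -, rfl⟩ := MvPolynomial.isUnit_iff_eq_C_of_isReduced.1 hu
  exact complexity_C_holds r

/-- Iterated submultiplicativity over a multiset. [folklore] -/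
private theorem complexity_multiset_prod_le {σ : Type*} (s : Multiset (MvPolynomial σ F)) :
    complexity s.prod ≤ (s.map complexity).sum + Multiset.card s := by
  induction s using Multiset.induction_on with
  | empty =>
    rw [Multiset.prod_zero, Multiset.map_zero, Multiset.sum_zero, Multiset.card_zero, ← C_1,
      complexity_C_holds]
  | cons a s ih =>
    rw [Multiset.prod_cons, Multiset.map_cons, Multiset.sum_cons, Multiset.card_cons]
    calc complexity (a * s.prod) ≤ complexity a + complexity s.prod + 1 :=
          complexity_mul_le_holds _ _
      _ ≤ complexity a + ((s.map complexity).sum + Multiset.card s) + 1 := by gcongr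
      _ = _ := by ring

/-- An irreducible polynomial has positive degree. [folklore] -/
private theorem totalDegree_pos_of_irreducible {σ : Type*} {q : MvPolynomial σ F}
    (hq : Irreducible q) : 0 < q.totalDegree := by
  rw [Nat.pos_iff_ne_zero]
  intro h0
  rw [totalDegree_eq_zero_iff_eq_C] at h0
  refine hq.not_isUnit ?_
  rw [h0]
  refine (isUnit_iff_ne_zero.2 fun hc => hq.ne_zero ?_).map C
  rw [h0, hc, C_0]

/-- A product of `k` nonconstant polynomials has degree `≥ k`. [folklore] -/
private theorem card_le_totalDegree_prod {σ : Type*} (s : Multiset (MvPolynomial σ F))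
    (h : ∀ q ∈ s, 0 < q.totalDegree) : s.prod ≠ 0 ∧ Multiset.card s ≤ s.prod.totalDegree := by
  induction s using Multiset.induction_on with
  | empty => simp
  | cons a s ih =>
    have ha : 0 < a.totalDegree := h a (Multiset.mem_cons_self a s)
    have ha0 : a ≠ 0 := fun h0 => by rw [h0, totalDegree_zero] at ha; exact lt_irrefl 0 ha
    obtain ⟨hs0, hcard⟩ := ih fun q hq => h q (Multiset.mem_cons_of_mem hq)
    refine ⟨by rw [Multiset.prod_cons]; exact mul_ne_zero ha0 hs0, ?_⟩
    rw [Multiset.prod_cons, totalDegree_mul_of_isDomain ha0 hs0, Multiset.card_cons]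
    omega

/-- Divisors involve no new variables (over a domain). [folklore] -/
private theorem vars_subset_vars_of_dvd {σ : Type*} {g f : MvPolynomial σ F} (hf : f ≠ 0)
    (h : g ∣ f) : g.vars ⊆ f.vars := by
  classical
  obtain ⟨h', rfl⟩ := h
  have hg : g ≠ 0 := left_ne_zero_of_mul hf
  have hh : h' ≠ 0 := right_ne_zero_of_mul hf
  intro i hi
  rw [vars_def, Multiset.mem_toFinset] at hi ⊢
  rw [degrees_mul_eq hg hh, Multiset.mem_add]
  exact Or.inl hi

/-- Injective renamings preserve the total degree. [folklore] -/
private theorem totalDegree_rename_of_injective {σ τ : Type*} {e : σ → τ}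
    (he : Function.Injective e) (p : MvPolynomial σ F) :
    (rename e p).totalDegree = p.totalDegree := by
  classical
  refine le_antisymm (totalDegree_rename_le e p) ?_
  rw [MvPolynomial.totalDegree, MvPolynomial.totalDegree, support_rename_of_injective he,
    Finset.sup_image]
  refine Finset.sup_le fun m hm => ?_
  refine le_trans (le_of_eq ?_) (Finset.le_sup hm)
  simp only [Function.comp_def]
  exact (Finsupp.sum_mapDomain_index_inj (h := fun (_ : τ) (e : ℕ) => e) he).symm

variable [IsAlgClosed F] [CharZero F]

/-- **Kaltofen's theorem for an arbitrary factor, with the variable count (fine form).** Over an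
algebraically closed field of characteristic zero, every factor `g` of `f ≠ 0` in `F[x_β]`
satisfies `L(g) ≤ d · (B + 1) + 1` where `B` is the bound of `complexity_le_of_irreducible_dvd`
(`d = deg f`): factor `g` into `≤ d` irreducibles (unique factorisation), each dividing `f`.
[cite: Burgisser2024Completeness, Thm. 3.2; DuttaSaxenaSinhababu2018, Cor. 5] -/
theorem complexity_le_of_dvd {β : Type*} [Fintype β] (f g : MvPolynomial β F) (hf : f ≠ 0)
    (hg : g ∣ f) :
    complexity g ≤ f.totalDegree *
      ((f.totalDegree + 2) ^ 2 * (f.totalDegree * (f.totalDegree *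
          ((f.totalDegree + 2) ^ 2 * (complexity f + 2 * Fintype.card β + 4) + Fintype.card β + 2)
          + 2) + f.totalDegree + 1) + (f.totalDegree + 1) + Fintype.card β + 1) + 1 := by
  classical
  set B := (f.totalDegree + 2) ^ 2 * (f.totalDegree * (f.totalDegree *
      ((f.totalDegree + 2) ^ 2 * (complexity f + 2 * Fintype.card β + 4) + Fintype.card β + 2)
      + 2) + f.totalDegree + 1) + (f.totalDegree + 1) + Fintype.card β with hB
  have hg0 : g ≠ 0 := fun h => hf (by obtain ⟨h', rfl⟩ := hg; rw [h, zero_mul])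
  set s := UniqueFactorizationMonoid.factors g with hs
  obtain ⟨u, hu⟩ := UniqueFactorizationMonoid.factors_prod hg0
  -- each irreducible factor is cheap
  have hq : ∀ q ∈ s, complexity q ≤ B := fun q hq =>
    complexity_le_of_irreducible_dvd f q hf (UniqueFactorizationMonoid.irreducible_of_factor q hq)
      ((UniqueFactorizationMonoid.dvd_of_mem_factors hq).trans hg)
  -- there are at most `d` of them
  have hpos : ∀ q ∈ s, 0 < q.totalDegree := fun q hq =>
    totalDegree_pos_of_irreducible (UniqueFactorizationMonoid.irreducible_of_factor q hq)
  obtain ⟨hs0, hcard⟩ := card_le_totalDegree_prod s hpos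
  have hcard' : Multiset.card s ≤ f.totalDegree := by
    refine hcard.trans ((totalDegree_le_of_dvd_of_isDomain ⟨(u : MvPolynomial β F), hu.symm⟩
      hg0).trans (totalDegree_le_of_dvd_of_isDomain hg hf))
  -- assemble
  have hprod : complexity s.prod ≤ Multiset.card s * B + Multiset.card s := by
    refine (complexity_multiset_prod_le s).trans ?_
    gcongr
    calc (s.map complexity).sum ≤ Multiset.card (s.map complexity) • B :=
          Multiset.sum_le_card_nsmul _ _ fun x hx => by
            obtain ⟨q, hq', rfl⟩ := Multiset.mem_map.1 hx
            exact hq q hq'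
      _ = Multiset.card s * B := by rw [Multiset.card_map, smul_eq_mul]
  calc complexity g = complexity (s.prod * (u : MvPolynomial β F)) := by rw [hu]
    _ ≤ complexity s.prod + complexity (u : MvPolynomial β F) + 1 := complexity_mul_le_holds _ _
    _ ≤ (Multiset.card s * B + Multiset.card s) + 0 + 1 := by
        gcongr
        exact (complexity_eq_zero_of_isUnit u.isUnit).le
    _ ≤ (f.totalDegree * B + f.totalDegree) + 0 + 1 := by gcongr
    _ = f.totalDegree * (B + 1) + 1 := by ring

/-- One-variable polynomial bound used for the exponent `12`. [folklore] -/
private theorem poly_bound (X : ℕ) (hX : 3 ≤ X) :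
    X * (X ^ 2 * (X * (X * (X ^ 2 * (5 * X) + 2 * X + 2) + 2) + X + 1) + (X + 1) + 2 * X + 1) +
      1 ≤ X ^ 12 := by
  have h1 : X * (X ^ 2 * (X * (X * (X ^ 2 * (5 * X) + 2 * X + 2) + 2) + X + 1) + (X + 1) +
      2 * X + 1) + 1 = 5 * X ^ 8 + 2 * X ^ 6 + 2 * X ^ 5 + 3 * X ^ 4 + X ^ 3 + 3 * X ^ 2 +
        2 * X + 1 := by ring
  rw [h1]
  have hX1 : 1 ≤ X := by omega
  have h6 : X ^ 6 ≤ X ^ 8 := Nat.pow_le_pow_right hX1 (by norm_num)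
  have h5 : X ^ 5 ≤ X ^ 8 := Nat.pow_le_pow_right hX1 (by norm_num)
  have h4 : X ^ 4 ≤ X ^ 8 := Nat.pow_le_pow_right hX1 (by norm_num)
  have h3 : X ^ 3 ≤ X ^ 8 := Nat.pow_le_pow_right hX1 (by norm_num)
  have h2 : X ^ 2 ≤ X ^ 8 := Nat.pow_le_pow_right hX1 (by norm_num)
  have h1' : X ≤ X ^ 8 := by
    calc X = X ^ 1 := (pow_one X).symm
      _ ≤ X ^ 8 := Nat.pow_le_pow_right hX1 (by norm_num)
  have h0 : 1 ≤ X ^ 8 := Nat.one_le_pow _ _ hX1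
  have h81 : 19 ≤ X ^ 4 := by
    calc 19 ≤ 3 ^ 4 := by norm_num
      _ ≤ X ^ 4 := Nat.pow_le_pow_left hX 4
  calc 5 * X ^ 8 + 2 * X ^ 6 + 2 * X ^ 5 + 3 * X ^ 4 + X ^ 3 + 3 * X ^ 2 + 2 * X + 1
      ≤ 19 * X ^ 8 := by omega
    _ ≤ X ^ 4 * X ^ 8 := Nat.mul_le_mul_right _ h81
    _ = X ^ 12 := by rw [← pow_add]

/-- The final arithmetic: the fine bound is below `(L + d + 2)^12` for `d ≥ 1`, `m ≤ 2L + 1`.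
[folklore] -/
private theorem final_arith (L d m : ℕ) (hm : m ≤ 2 * L + 1) (hd : 0 < d) :
    d * ((d + 2) ^ 2 * (d * (d * ((d + 2) ^ 2 * (L + 2 * m + 4) + m + 2) + 2) + d + 1) +
      (d + 1) + m + 1) + 1 ≤ (L + d + 2) ^ 12 := by
  set X := L + d + 2 with hX
  have h3 : 3 ≤ X := by omega
  have hdX : d ≤ X := by omega
  have hd2 : d + 2 ≤ X := by omega
  have hmX : m ≤ 2 * X := by omega
  have h5 : L + 2 * m + 4 ≤ 5 * X := by omega
  have hd1 : d + 1 ≤ X + 1 := by omega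
  calc d * ((d + 2) ^ 2 * (d * (d * ((d + 2) ^ 2 * (L + 2 * m + 4) + m + 2) + 2) + d + 1) +
        (d + 1) + m + 1) + 1
      ≤ X * (X ^ 2 * (X * (X * (X ^ 2 * (5 * X) + 2 * X + 2) + 2) + X + 1) + (X + 1) +
        2 * X + 1) + 1 := by gcongr
    _ ≤ X ^ 12 := poly_bound X h3

end Assembly

/-! ### Arbitrary fields of characteristic zero: coprimality data instead of roots
(`KaltofenFactorDescent.complexity_le_of_coprimeData`) -/

section CoprimePoint

variable {F : Type*} [Field F] {β : Type*}

/-- **A good expansion point, coprimality form** (Dutta–Saxena–Sinhababu 2018, Lemma 26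
"coprimality": "`β̄` is random, so `f̃ᵢ(0̄, y)` and the cofactors stay coprime"): under the
hypotheses of `exists_bezout_eq_C`, over an infinite field there is a point `b` at which the
specialisations `Pm(b; Y)` and `T(b; Y)` are coprime in `F[Y]` (no roots needed).
[cite: DuttaSaxenaSinhababu2018, Lemma 26 and Thm. 4 (arXiv numbering)] -/
theorem exists_coprimePoint [Infinite F] {Pm T : Polynomial (MvPolynomial β F)} (hm : Pm.Monic)
    (hirr : Irreducible Pm) (hT : ¬ Pm ∣ T) :
    ∃ b : β → F, IsCoprime (Pm.map (eval b)) (T.map (eval b)) := by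
  obtain ⟨A, B, w, hw, hAB⟩ := exists_bezout_eq_C hm hirr hT
  obtain ⟨b, hb⟩ : ∃ b : β → F, eval b w ≠ 0 := by
    by_contra h
    push Not at h
    exact hw (MvPolynomial.funext fun x => by rw [h x, map_zero])
  refine ⟨b, Polynomial.C (eval b w)⁻¹ * A.map (eval b), Polynomial.C (eval b w)⁻¹ * B.map (eval b),
    ?_⟩
  have h1 := congrArg (Polynomial.map (eval b)) hAB
  simp only [Polynomial.map_add, Polynomial.map_mul, Polynomial.map_C] at h1
  calc Polynomial.C (eval b w)⁻¹ * A.map (eval b) * Pm.map (eval b) +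
        Polynomial.C (eval b w)⁻¹ * B.map (eval b) * T.map (eval b)
      = Polynomial.C (eval b w)⁻¹ * (A.map (eval b) * Pm.map (eval b) +
          B.map (eval b) * T.map (eval b)) := by ring
    _ = 1 := by rw [h1, ← Polynomial.C_mul, inv_mul_cancel₀ hb, Polynomial.C_1]

end CoprimePoint

section CoreCharZero

variable {F : Type*} [Field F] [CharZero F] {β : Type*} [Fintype β]

/-- **Kaltofen's theorem for one irreducible factor over an ARBITRARY field of characteristic zero
(fine form).** If `p` is irreducible and divides `f ≠ 0` in `F[x_β]`, then
`L(p) ≤ (d+2)² (8(d+1)⁷ + d² ((5d³+6d²+2d)(d (L_G + 2) + 1) + 3d + 2) + 1) + (d+1) + n` with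
`L_G = (d+2)² (L(f) + 2n + 4) + n`, `d = deg f`, `n = #β`. Same route as
`complexity_le_of_irreducible_dvd` (shear, differentiate `multiplicity − 1` times, translate to a
good point), except that the good point only provides COPRIMALITY of `Pm(b; Y)` and
`(Q · ∂Pm)(b; Y)` (`exists_coprimePoint`; no roots in `F` are needed) and the engine is the étale
descent `KaltofenFactor.complexity_le_of_coprimeData` (Newton iteration over `F[T]/(Pm(b;T))`,
characteristic polynomial, Vandermonde conjugation over the algebraic closure).
[cite: DuttaSaxenaSinhababu2018, Thm. 4, Cor. 5 and proof of Thm. 1; Burgisser2024Completeness, Thm. 3.2] -/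
theorem complexity_le_of_irreducible_dvd_charZero (f p : MvPolynomial β F) (hf : f ≠ 0)
    (hp : Irreducible p) (hdvd : p ∣ f) :
    complexity p ≤
      (f.totalDegree + 2) ^ 2 * (8 * (f.totalDegree + 1) ^ 7 + f.totalDegree ^ 2 *
        ((5 * f.totalDegree ^ 3 + 6 * f.totalDegree ^ 2 + 2 * f.totalDegree) *
          (f.totalDegree * (((f.totalDegree + 2) ^ 2 * (complexity f + 2 * Fintype.card β + 4) +
            Fintype.card β) + 2) + 1) + 3 * f.totalDegree + 2) + 1) + (f.totalDegree + 1) +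
        Fintype.card β := by
  classical
  -- degrees
  have hp0 : p ≠ 0 := hp.ne_zero
  have hδd : p.totalDegree ≤ f.totalDegree := totalDegree_le_of_dvd_of_isDomain hdvd hf
  have hδpos : 0 < p.totalDegree := by
    rw [Nat.pos_iff_ne_zero]
    intro h0
    rw [totalDegree_eq_zero_iff_eq_C] at h0
    refine hp.not_isUnit ?_
    rw [h0]
    refine (isUnit_iff_ne_zero.2 fun hc => hp0 ?_).map C
    rw [h0, hc, C_0]
  -- Step 1: a direction `a` with `p_δ(a) ≠ 0`
  obtain ⟨a, ha⟩ : ∃ a : β → F, eval a (homogeneousComponent p.totalDegree p) ≠ 0 := by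
    by_contra h
    push Not at h
    exact homogeneousComponent_totalDegree_ne_zero hp0
      (MvPolynomial.funext fun x => by rw [h x, map_zero])
  -- Step 2: the shear
  set Ph₀ : MvPolynomial (Option β) F :=
    aeval (fun b : β => X (some b) + C (a b) * X none) p with hPh₀
  set fh : MvPolynomial (Option β) F :=
    aeval (fun b : β => X (some b) + C (a b) * X none) f with hfh
  set a₀ : F := eval a (homogeneousComponent p.totalDegree p) with ha₀
  set P₁ : Polynomial (MvPolynomial β F) := optionEquivLeft F β Ph₀ with hP₁
  obtain ⟨hnat, hlc⟩ := natDegree_leadingCoeff_optionEquivLeft_shear a p ha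
  rw [← hPh₀, ← hP₁] at hnat hlc
  set Pm : Polynomial (MvPolynomial β F) := Polynomial.C (C a₀⁻¹) * P₁ with hPm
  have hCC : Polynomial.C (C a₀) * Polynomial.C (C a₀⁻¹) =
      (1 : Polynomial (MvPolynomial β F)) := by
    rw [← Polynomial.C_mul, ← C_mul, mul_inv_cancel₀ ha, C_1, Polynomial.C_1]
  have hP₁eq : P₁ = Polynomial.C (C a₀) * Pm := by
    rw [hPm, ← mul_assoc, hCC, one_mul]
  have hPm_monic : Pm.Monic := by
    refine Polynomial.monic_C_mul_of_mul_leadingCoeff_eq_one ?_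
    rw [hlc, ← C_mul, inv_mul_cancel₀ ha, C_1]
  have hPm_natDegree : Pm.natDegree = p.totalDegree := by
    rw [hPm, Polynomial.natDegree_C_mul (C_ne_zero.2 (inv_ne_zero ha))]
    exact hnat
  have hPm_deg0 : Pm.natDegree ≠ 0 := by rw [hPm_natDegree]; exact hδpos.ne'
  have hPm_prime : Prime Pm := by
    have h := prime_optionEquivLeft_shear a (UniqueFactorizationMonoid.irreducible_iff_prime.1 hp)
    rw [← hPh₀, ← hP₁] at h
    obtain ⟨u, hu⟩ := Polynomial.isUnit_C.2
      ((isUnit_iff_ne_zero.2 (inv_ne_zero ha)).map (C : F →+* MvPolynomial β F))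
    refine Associated.prime ⟨u, ?_⟩ h
    rw [hPm, hu, mul_comm]
  -- Step 3: multiplicity reduction
  have hfh0 : fh ≠ 0 := by
    intro h
    apply hf
    rw [← aeval_kill_shear a f, ← hfh, h, map_zero]
  set f₁ : Polynomial (MvPolynomial β F) := optionEquivLeft F β fh with hf₁
  have hf₁0 : f₁ ≠ 0 := by
    rw [hf₁]; exact (EmbeddingLike.map_ne_zero_iff).2 hfh0
  have hPm_dvd : Pm ∣ f₁ := by
    obtain ⟨h, hfeq⟩ := hdvd
    refine ⟨Polynomial.C (C a₀) * optionEquivLeft F β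
      (aeval (fun b : β => X (some b) + C (a b) * X none) h), ?_⟩
    rw [hf₁, hfh, hfeq, map_mul, map_mul, ← hPh₀, ← hP₁, hP₁eq]
    ring
  obtain ⟨k, Q, hψ, hQ⟩ := exists_iterate_derivative_eq_mul hf₁0 hPm_prime hPm_dvd hPm_deg0
  -- Step 4: a good expansion point (coprimality form; `F` is infinite in characteristic zero)
  have hT : ¬ Pm ∣ Q * Polynomial.derivative Pm := by
    intro h
    rcases hPm_prime.dvd_or_dvd h with h1 | h1
    · exact hQ h1
    · have hne : Polynomial.derivative Pm ≠ 0 := Polynomial.derivative_ne_zero.2 hPm_deg0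
      exact absurd (Polynomial.natDegree_le_of_dvd h1 hne)
        (not_le.2 (Polynomial.natDegree_derivative_lt hPm_deg0))
  obtain ⟨b, hb⟩ := exists_coprimePoint hPm_monic hPm_prime.irreducible hT
  -- Step 5: translate by `b`
  set θ : Option β → MvPolynomial (Option β) F :=
    fun o => o.elim (X none) fun b' => X (some b') + C (b b') with hθ
  set τ : MvPolynomial β F →+* MvPolynomial β F :=
    ((aeval fun b' : β => X b' + C (b b') : MvPolynomial β F →ₐ[F] MvPolynomial β F) :
      MvPolynomial β F →+* MvPolynomial β F) with hτ
  set G : MvPolynomial (Option β) F := aeval θ ((optionEquivLeft F β).symm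
    (Polynomial.derivative^[k] f₁)) with hG
  set Ph : MvPolynomial (Option β) F := aeval θ Ph₀ with hPh
  have hτC : τ (C a₀) = C a₀ := by
    rw [hτ, AlgHom.coe_toRingHom, aeval_C, algebraMap_eq]
  have hEG : optionEquivLeft F β G = Polynomial.map τ (Polynomial.derivative^[k] f₁) := by
    rw [hG, hθ, hτ, optionEquivLeft_aeval_translate, AlgEquiv.apply_symm_apply]
  have hEPh : optionEquivLeft F β Ph = Polynomial.map τ P₁ := by
    rw [hPh, hθ, hτ, optionEquivLeft_aeval_translate, ← hP₁]
  set P : Polynomial (MvPolynomial β F) := Pm.map τ with hPdef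
  set Qt : Polynomial (MvPolynomial β F) := Q.map τ with hQt
  have hP_monic : P.Monic := hPm_monic.map τ
  have hP_natDegree : P.natDegree = p.totalDegree := by
    rw [hPdef, hPm_monic.natDegree_map]; exact hPm_natDegree
  have hEG' : optionEquivLeft F β G = P * Qt := by rw [hEG, hψ, Polynomial.map_mul]
  have hEPh' : optionEquivLeft F β Ph = Polynomial.C (C a₀) * P := by
    rw [hEPh, hP₁eq, Polynomial.map_mul, Polynomial.map_C, hτC]
  -- coprimality data at `x = 0` after translation = at `x = b` before
  have hPcc : P.map (constantCoeff : MvPolynomial β F →+* F) = Pm.map (eval b) := by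
    rw [hPdef, hτ, Polynomial.map_map, constantCoeff_comp_translate]
  have hTcc : (Qt * Polynomial.derivative P).map (constantCoeff : MvPolynomial β F →+* F) =
      (Q * Polynomial.derivative Pm).map (eval b) := by
    rw [hQt, hPdef, Polynomial.derivative_map, ← Polynomial.map_mul, hτ, Polynomial.map_map,
      constantCoeff_comp_translate]
  have hcop : IsCoprime (P.map (constantCoeff : MvPolynomial β F →+* F))
      ((Qt * Polynomial.derivative P).map (constantCoeff : MvPolynomial β F →+* F)) := by
    rw [hPcc, hTcc]; exact hb
  have hPh_deg : Ph.totalDegree ≤ f.totalDegree :=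
    (totalDegree_translate_le b Ph₀).trans ((totalDegree_shear_le a p).trans hδd)
  -- the engine (étale descent)
  have hcore := complexity_le_of_coprimeData G Ph a₀ P Qt hP_monic hEG' hEPh' hcop hPh_deg
  -- the costs
  have hfh_deg : fh.degreeOf none ≤ f.totalDegree :=
    (degreeOf_le_totalDegree fh none).trans (totalDegree_shear_le a f)
  have hG_c : complexity G ≤ (f.totalDegree + 2) ^ 2 * (complexity f + 2 * Fintype.card β + 4) +
      Fintype.card β := by
    calc complexity G
        ≤ complexity ((optionEquivLeft F β).symm (Polynomial.derivative^[k] f₁)) +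
            Fintype.card β := complexity_translate_le b _
      _ ≤ (f.totalDegree + 2) ^ 2 * (complexity fh + 4) + Fintype.card β := by
          gcongr
          rw [hf₁]
          exact complexity_optionEquivLeft_symm_iterate_derivative_le fh k hfh_deg
      _ ≤ (f.totalDegree + 2) ^ 2 * (complexity f + 2 * Fintype.card β + 4) + Fintype.card β := by
          gcongr
          exact complexity_shear_le a f
  have hPh₀_c : complexity Ph₀ ≤ complexity Ph + Fintype.card β := by
    have h : aeval (fun o : Option β => o.elim (X none) fun b' => X (some b') + C ((fun b'' =>
        -b b'') b')) Ph = Ph₀ := by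
      rw [hPh, hθ]
      exact aeval_translate_neg_translate b Ph₀
    calc complexity Ph₀ = complexity (aeval (fun o : Option β => o.elim (X none) fun b' =>
          X (some b') + C ((fun b'' => -b b'') b')) Ph) := by rw [h]
      _ ≤ complexity Ph + Fintype.card β := complexity_translate_le (fun b'' => -b b'') Ph
  have hp_c : complexity p ≤ complexity Ph₀ := by
    have h : aeval (fun o : Option β => o.elim (0 : MvPolynomial β F) X) Ph₀ = p := by
      rw [hPh₀]; exact aeval_kill_shear a p
    calc complexity p
        = complexity (aeval (fun o : Option β => o.elim (0 : MvPolynomial β F) X) Ph₀) := by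
          rw [h]
      _ ≤ complexity Ph₀ := complexity_kill_le Ph₀
  have hPd : P.natDegree ≤ f.totalDegree := by rw [hP_natDegree]; exact hδd
  -- assembly
  calc complexity p ≤ complexity Ph₀ := hp_c
    _ ≤ complexity Ph + Fintype.card β := hPh₀_c
    _ ≤ (f.totalDegree + 2) ^ 2 * (8 * (P.natDegree + 1) ^ 7 + P.natDegree ^ 2 *
        ((5 * P.natDegree ^ 3 + 6 * P.natDegree ^ 2 + 2 * P.natDegree) *
          (f.totalDegree * (complexity G + 2) + 1) + 3 * P.natDegree + 2) + 1) +
        (f.totalDegree + 1) + Fintype.card β := by gcongr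
    _ ≤ (f.totalDegree + 2) ^ 2 * (8 * (f.totalDegree + 1) ^ 7 + f.totalDegree ^ 2 *
        ((5 * f.totalDegree ^ 3 + 6 * f.totalDegree ^ 2 + 2 * f.totalDegree) *
          (f.totalDegree * (((f.totalDegree + 2) ^ 2 * (complexity f + 2 * Fintype.card β + 4) +
            Fintype.card β) + 2) + 1) + 3 * f.totalDegree + 2) + 1) + (f.totalDegree + 1) +
        Fintype.card β := by gcongr

end CoreCharZero

section AssemblyCharZero

variable {F : Type*} [Field F] [CharZero F]

/-- **Kaltofen's theorem for an arbitrary factor over an arbitrary field of characteristic zero,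
with the variable count (fine form):** every factor `g` of `f ≠ 0` in `F[x_β]` satisfies
`L(g) ≤ d · (B + 1) + 1` where `B` is the bound of `complexity_le_of_irreducible_dvd_charZero`
(`d = deg f`): factor `g` into `≤ d` irreducibles (unique factorisation), each dividing `f`.
[cite: Burgisser2024Completeness, Thm. 3.2; DuttaSaxenaSinhababu2018, Cor. 5] -/
theorem complexity_le_of_dvd_charZero {β : Type*} [Fintype β] (f g : MvPolynomial β F) (hf : f ≠ 0)
    (hg : g ∣ f) :
    complexity g ≤ f.totalDegree *
      ((f.totalDegree + 2) ^ 2 * (8 * (f.totalDegree + 1) ^ 7 + f.totalDegree ^ 2 *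
        ((5 * f.totalDegree ^ 3 + 6 * f.totalDegree ^ 2 + 2 * f.totalDegree) *
          (f.totalDegree * (((f.totalDegree + 2) ^ 2 * (complexity f + 2 * Fintype.card β + 4) +
            Fintype.card β) + 2) + 1) + 3 * f.totalDegree + 2) + 1) + (f.totalDegree + 1) +
        Fintype.card β + 1) + 1 := by
  classical
  set B := (f.totalDegree + 2) ^ 2 * (8 * (f.totalDegree + 1) ^ 7 + f.totalDegree ^ 2 *
      ((5 * f.totalDegree ^ 3 + 6 * f.totalDegree ^ 2 + 2 * f.totalDegree) *
        (f.totalDegree * (((f.totalDegree + 2) ^ 2 * (complexity f + 2 * Fintype.card β + 4) +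
          Fintype.card β) + 2) + 1) + 3 * f.totalDegree + 2) + 1) + (f.totalDegree + 1) +
      Fintype.card β with hB
  have hg0 : g ≠ 0 := fun h => hf (by obtain ⟨h', rfl⟩ := hg; rw [h, zero_mul])
  set s := UniqueFactorizationMonoid.factors g with hs
  obtain ⟨u, hu⟩ := UniqueFactorizationMonoid.factors_prod hg0
  -- each irreducible factor is cheap
  have hq : ∀ q ∈ s, complexity q ≤ B := fun q hq =>
    complexity_le_of_irreducible_dvd_charZero f q hf
      (UniqueFactorizationMonoid.irreducible_of_factor q hq)
      ((UniqueFactorizationMonoid.dvd_of_mem_factors hq).trans hg)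
  -- there are at most `d` of them
  have hpos : ∀ q ∈ s, 0 < q.totalDegree := fun q hq =>
    totalDegree_pos_of_irreducible (UniqueFactorizationMonoid.irreducible_of_factor q hq)
  obtain ⟨hs0, hcard⟩ := card_le_totalDegree_prod s hpos
  have hcard' : Multiset.card s ≤ f.totalDegree := by
    refine hcard.trans ((totalDegree_le_of_dvd_of_isDomain ⟨(u : MvPolynomial β F), hu.symm⟩
      hg0).trans (totalDegree_le_of_dvd_of_isDomain hg hf))
  -- assemble
  have hprod : complexity s.prod ≤ Multiset.card s * B + Multiset.card s := by
    refine (complexity_multiset_prod_le s).trans ?_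
    gcongr
    calc (s.map complexity).sum ≤ Multiset.card (s.map complexity) • B :=
          Multiset.sum_le_card_nsmul _ _ fun x hx => by
            obtain ⟨q, hq', rfl⟩ := Multiset.mem_map.1 hx
            exact hq q hq'
      _ = Multiset.card s * B := by rw [Multiset.card_map, smul_eq_mul]
  calc complexity g = complexity (s.prod * (u : MvPolynomial β F)) := by rw [hu]
    _ ≤ complexity s.prod + complexity (u : MvPolynomial β F) + 1 := complexity_mul_le_holds _ _
    _ ≤ (Multiset.card s * B + Multiset.card s) + 0 + 1 := by
        gcongr
        exact (complexity_eq_zero_of_isUnit u.isUnit).le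
    _ ≤ (f.totalDegree * B + f.totalDegree) + 0 + 1 := by gcongr
    _ = f.totalDegree * (B + 1) + 1 := by ring

/-- One-variable polynomial bound used for the exponent `17`. [folklore] -/
private theorem poly_bound_charZero (X : ℕ) (hX : 3 ≤ X) :
    X * (X ^ 2 * (8 * X ^ 7 + X ^ 2 * ((5 * X ^ 3 + 6 * X ^ 2 + 2 * X) *
        (X * (5 * X ^ 3 + 2 * X + 2) + 1) + 3 * X + 2) + 1) + X + 2 * X + 1) + 1 ≤ X ^ 17 := by
  have hX1 : 1 ≤ X := by omega
  have hmono : ∀ k : ℕ, k ≤ 12 → X ^ k ≤ X ^ 12 := fun k hk => Nat.pow_le_pow_right hX1 hk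
  have h1 : X * (X ^ 2 * (8 * X ^ 7 + X ^ 2 * ((5 * X ^ 3 + 6 * X ^ 2 + 2 * X) *
        (X * (5 * X ^ 3 + 2 * X + 2) + 1) + 3 * X + 2) + 1) + X + 2 * X + 1) + 1 =
      25 * X ^ 12 + 30 * X ^ 11 + 28 * X ^ 10 + 22 * X ^ 9 + 21 * X ^ 8 + 10 * X ^ 7 +
        5 * X ^ 6 + 2 * X ^ 5 + X ^ 3 + 3 * X ^ 2 + X + 1 := by ring
  rw [h1]
  have h11 := hmono 11 (by norm_num)
  have h10 := hmono 10 (by norm_num)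
  have h9 := hmono 9 (by norm_num)
  have h8 := hmono 8 (by norm_num)
  have h7 := hmono 7 (by norm_num)
  have h6 := hmono 6 (by norm_num)
  have h5 := hmono 5 (by norm_num)
  have h3 := hmono 3 (by norm_num)
  have h2 := hmono 2 (by norm_num)
  have h1' : X ≤ X ^ 12 := by
    calc X = X ^ 1 := (pow_one X).symm
      _ ≤ X ^ 12 := hmono 1 (by norm_num)
  have h0 : 1 ≤ X ^ 12 := Nat.one_le_pow _ _ hX1
  have h149 : 149 ≤ X ^ 5 := by
    calc 149 ≤ 3 ^ 5 := by norm_num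
      _ ≤ X ^ 5 := Nat.pow_le_pow_left hX 5
  calc 25 * X ^ 12 + 30 * X ^ 11 + 28 * X ^ 10 + 22 * X ^ 9 + 21 * X ^ 8 + 10 * X ^ 7 +
        5 * X ^ 6 + 2 * X ^ 5 + X ^ 3 + 3 * X ^ 2 + X + 1
      ≤ 149 * X ^ 12 := by omega
    _ ≤ X ^ 5 * X ^ 12 := Nat.mul_le_mul_right _ h149
    _ = X ^ 17 := by rw [← pow_add]

/-- The final arithmetic over an arbitrary field of characteristic zero: the fine bound is below
`(L + d + 2)^17` for `d ≥ 1`, `m ≤ 2L + 1`. [folklore] -/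
private theorem final_arith_charZero (L d m : ℕ) (hm : m ≤ 2 * L + 1) (hd : 0 < d) :
    d * ((d + 2) ^ 2 * (8 * (d + 1) ^ 7 + d ^ 2 * ((5 * d ^ 3 + 6 * d ^ 2 + 2 * d) *
        (d * (((d + 2) ^ 2 * (L + 2 * m + 4) + m) + 2) + 1) + 3 * d + 2) + 1) + (d + 1) + m + 1) +
      1 ≤ (L + d + 2) ^ 17 := by
  set X := L + d + 2 with hX
  have h3 : 3 ≤ X := by omega
  have hdX : d ≤ X := by omega
  have hd2 : d + 2 ≤ X := by omega
  have hd1 : d + 1 ≤ X := by omega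
  have hmX : m ≤ 2 * X := by omega
  have h5 : (d + 2) ^ 2 * (L + 2 * m + 4) + m + 2 ≤ 5 * X ^ 3 + 2 * X + 2 := by
    have h5' : L + 2 * m + 4 ≤ 5 * X := by omega
    calc (d + 2) ^ 2 * (L + 2 * m + 4) + m + 2 ≤ X ^ 2 * (5 * X) + 2 * X + 2 := by gcongr
      _ = 5 * X ^ 3 + 2 * X + 2 := by ring
  calc d * ((d + 2) ^ 2 * (8 * (d + 1) ^ 7 + d ^ 2 * ((5 * d ^ 3 + 6 * d ^ 2 + 2 * d) *
        (d * (((d + 2) ^ 2 * (L + 2 * m + 4) + m) + 2) + 1) + 3 * d + 2) + 1) + (d + 1) + m + 1) +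
        1
      = d * ((d + 2) ^ 2 * (8 * (d + 1) ^ 7 + d ^ 2 * ((5 * d ^ 3 + 6 * d ^ 2 + 2 * d) *
        (d * ((d + 2) ^ 2 * (L + 2 * m + 4) + m + 2) + 1) + 3 * d + 2) + 1) + (d + 1) + m + 1) +
        1 := by ring
    _ ≤ X * (X ^ 2 * (8 * X ^ 7 + X ^ 2 * ((5 * X ^ 3 + 6 * X ^ 2 + 2 * X) *
        (X * (5 * X ^ 3 + 2 * X + 2) + 1) + 3 * X + 2) + 1) + X + 2 * X + 1) + 1 := by gcongr
    _ ≤ X ^ 17 := poly_bound_charZero X h3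

end AssemblyCharZero

end KaltofenFactor

/-! ### The discharge -/

section Main

open KaltofenFactor

/-- **Kaltofen's theorem (Kaltofen 1989; Bürgisser 2024, Thm. 3.2), PROVED over every
algebraically closed field of characteristic zero, with the explicit exponent `κ = 12`:**
for all `n` and all `f, g ∈ F[x_1, …, x_n]` with `f ≠ 0`, `g ∣ f`:
`L(g) ≤ (L(f) + deg f + 2)^12`. This is the tree's named fact `KaltofenFactorBoundWith F 12`
(`KaltofenFactorClosure.lean`) for such `F` — in particular for the summit field `ℂ`. Proof: restrict
to the `≤ 2 L(f) + 1` variables occurring in `f` (`ArithCircuit.card_vars_le_two_mul_complexity_add_one`;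
divisors involve no new variables), then `complexity_le_of_dvd`. Route ≠ Kaltofen's printed Hensel
lifting: the power-series-roots route of Bürgisser 2004 §3 / Dutta–Saxena–Sinhababu 2018
(Thm. 4, Cor. 5) — DISCLOSED DEVIATION; the statement is the printed one (existence of small
circuits for every factor). NOT covered: non-algebraically-closed fields of characteristic zero
(e.g. `ℚ`: the roots used as circuit constants live in `F̄`; Hensel lifting would be needed),
positive characteristic (where only `g^{p^k}` is obtained). [cite: Burgisser2024Completeness, Thm. 3.2] -/
theorem kaltofenFactorBoundWith_of_isAlgClosed (F : Type*) [Field F] [IsAlgClosed F]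
    [CharZero F] : KaltofenFactorBoundWith F 12 := by
  intro n f g hf hg
  classical
  -- constants
  by_cases hd : f.totalDegree = 0
  · have hg0 : g.totalDegree = 0 := by
      have := totalDegree_le_of_dvd_of_isDomain hg hf
      omega
    rw [complexity_eq_zero_of_totalDegree_eq_zero g hg0]
    exact Nat.zero_le _
  -- restrict to the variables of `f`
  obtain ⟨f', hf'⟩ := exists_rename_eq_of_vars_subset_range f ((↑) : f.vars → Fin n)
    Subtype.val_injective (fun i hi => ⟨⟨i, hi⟩, rfl⟩)
  obtain ⟨h, hfgh⟩ := hg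
  have hgv : (↑g.vars : Set (Fin n)) ⊆ Set.range ((↑) : f.vars → Fin n) := fun i hi =>
    ⟨⟨i, vars_subset_vars_of_dvd hf ⟨h, hfgh⟩ (Finset.mem_coe.1 hi)⟩, rfl⟩
  have hhv : (↑h.vars : Set (Fin n)) ⊆ Set.range ((↑) : f.vars → Fin n) := fun i hi =>
    ⟨⟨i, vars_subset_vars_of_dvd hf ⟨g, by rw [hfgh, mul_comm]⟩ (Finset.mem_coe.1 hi)⟩, rfl⟩
  obtain ⟨g', hg'⟩ := exists_rename_eq_of_vars_subset_range g _ Subtype.val_injective hgv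
  obtain ⟨h', hh'⟩ := exists_rename_eq_of_vars_subset_range h _ Subtype.val_injective hhv
  have hf'eq : f' = g' * h' :=
    rename_injective _ Subtype.val_injective (by rw [map_mul, hg', hh', hf', hfgh])
  have hf'0 : f' ≠ 0 := by
    rintro rfl
    rw [map_zero] at hf'
    exact hf hf'.symm
  have key := complexity_le_of_dvd f' g' hf'0 ⟨h', hf'eq⟩
  -- transport the numbers
  have hLf : complexity f' = complexity f := by
    have h1 := complexity_rename_of_injective_holds Subtype.val_injective f'
    rw [hf'] at h1
    exact h1.symm
  have hLg : complexity g = complexity g' := by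
    have h1 := complexity_rename_of_injective_holds Subtype.val_injective g'
    rw [hg'] at h1
    exact h1
  have hdf : f'.totalDegree = f.totalDegree := by
    have h1 := totalDegree_rename_of_injective Subtype.val_injective f'
    rw [hf'] at h1
    exact h1.symm
  have hm : Fintype.card f.vars ≤ 2 * complexity f + 1 := by
    rw [Fintype.card_coe]
    exact ArithCircuit.card_vars_le_two_mul_complexity_add_one f
  rw [hLg]
  rw [hLf, hdf] at key
  exact key.trans (final_arith _ _ _ hm (Nat.pos_of_ne_zero hd))

/-- **Kaltofen's theorem: `KaltofenFactorBound F` holds for every algebraically closed field `F` of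
characteristic zero** (the tree's NAMED FACT of `KaltofenFactorClosure.lean`, discharged for such
fields; some absolute exponent — here `12` — works). [cite: Burgisser2024Completeness, Thm. 3.2] -/
theorem kaltofenFactorBound_of_isAlgClosed (F : Type*) [Field F] [IsAlgClosed F] [CharZero F] :
    KaltofenFactorBound F :=
  ⟨12, kaltofenFactorBoundWith_of_isAlgClosed F⟩

/-- **Kaltofen's theorem over `ℂ`** (the summit field): `KaltofenFactorBound ℂ`.
[cite: Burgisser2024Completeness, Thm. 3.2 and Cor. 3.3] -/
theorem kaltofenFactorBound_complex : KaltofenFactorBound ℂ :=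
  kaltofenFactorBound_of_isAlgClosed ℂ

/-- **Kaltofen's theorem (Kaltofen 1989; Bürgisser 2024, Thm. 3.2), PROVED over EVERY field of
characteristic zero, with the explicit exponent `κ = 17`:** for all `n` and all
`f, g ∈ F[x_1, …, x_n]` with `f ≠ 0`, `g ∣ f`: `L(g) ≤ (L(f) + deg f + 2)^17` — the tree's named
fact `KaltofenFactorBoundWith F 17` for every `F` of characteristic zero (in particular `ℚ`, the
field of `BIJL18PermanentZeroFactorClosureProofs.lean`). Same proof as
`kaltofenFactorBoundWith_of_isAlgClosed` with `KaltofenFactor.complexity_le_of_dvd_charZero`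
(étale descent of the all-roots route: the roots of the specialised factor are replaced by the
generic root `θ ∈ F[T]/(Pm(b;T))` and the product over the roots by a characteristic polynomial;
`KaltofenFactorDescent.lean`). Route ≠ Kaltofen's printed Hensel lifting — DISCLOSED DEVIATION;
the statement is the printed one. NOT covered: positive characteristic.
[cite: Burgisser2024Completeness, Thm. 3.2; Kaltofen1989, Thm. 5] -/
theorem kaltofenFactorBoundWith_of_charZero (F : Type*) [Field F] [CharZero F] :
    KaltofenFactorBoundWith F 17 := by
  intro n f g hf hg
  classical
  -- constants
  by_cases hd : f.totalDegree = 0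
  · have hg0 : g.totalDegree = 0 := by
      have := totalDegree_le_of_dvd_of_isDomain hg hf
      omega
    rw [complexity_eq_zero_of_totalDegree_eq_zero g hg0]
    exact Nat.zero_le _
  -- restrict to the variables of `f`
  obtain ⟨f', hf'⟩ := exists_rename_eq_of_vars_subset_range f ((↑) : f.vars → Fin n)
    Subtype.val_injective (fun i hi => ⟨⟨i, hi⟩, rfl⟩)
  obtain ⟨h, hfgh⟩ := hg
  have hgv : (↑g.vars : Set (Fin n)) ⊆ Set.range ((↑) : f.vars → Fin n) := fun i hi =>
    ⟨⟨i, vars_subset_vars_of_dvd hf ⟨h, hfgh⟩ (Finset.mem_coe.1 hi)⟩, rfl⟩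
  have hhv : (↑h.vars : Set (Fin n)) ⊆ Set.range ((↑) : f.vars → Fin n) := fun i hi =>
    ⟨⟨i, vars_subset_vars_of_dvd hf ⟨g, by rw [hfgh, mul_comm]⟩ (Finset.mem_coe.1 hi)⟩, rfl⟩
  obtain ⟨g', hg'⟩ := exists_rename_eq_of_vars_subset_range g _ Subtype.val_injective hgv
  obtain ⟨h', hh'⟩ := exists_rename_eq_of_vars_subset_range h _ Subtype.val_injective hhv
  have hf'eq : f' = g' * h' :=
    rename_injective _ Subtype.val_injective (by rw [map_mul, hg', hh', hf', hfgh])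
  have hf'0 : f' ≠ 0 := by
    rintro rfl
    rw [map_zero] at hf'
    exact hf hf'.symm
  have key := complexity_le_of_dvd_charZero f' g' hf'0 ⟨h', hf'eq⟩
  -- transport the numbers
  have hLf : complexity f' = complexity f := by
    have h1 := complexity_rename_of_injective_holds Subtype.val_injective f'
    rw [hf'] at h1
    exact h1.symm
  have hLg : complexity g = complexity g' := by
    have h1 := complexity_rename_of_injective_holds Subtype.val_injective g'
    rw [hg'] at h1
    exact h1
  have hdf : f'.totalDegree = f.totalDegree := by
    have h1 := totalDegree_rename_of_injective Subtype.val_injective f'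
    rw [hf'] at h1
    exact h1.symm
  have hm : Fintype.card f.vars ≤ 2 * complexity f + 1 := by
    rw [Fintype.card_coe]
    exact ArithCircuit.card_vars_le_two_mul_complexity_add_one f
  rw [hLg]
  rw [hLf, hdf] at key
  exact key.trans (final_arith_charZero _ _ _ hm (Nat.pos_of_ne_zero hd))

/-- **Kaltofen's theorem: the named fact `KaltofenFactorBound F` (`KaltofenFactorClosure.lean`)
DISCHARGED for every field `F` of characteristic zero** — exactly the hypotheses of the fact
(some absolute exponent, here `17`, works). [cite: Burgisser2024Completeness, Thm. 3.2; Kaltofen1989, Thm. 5] -/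
theorem kaltofenFactorBound_holds (F : Type*) [Field F] [CharZero F] : KaltofenFactorBound F :=
  ⟨17, kaltofenFactorBoundWith_of_charZero F⟩

/-- **Kaltofen's theorem over `ℚ`**: `KaltofenFactorBound ℚ` (the field of the
Bürgisser–Ikenmeyer–Jindal–Landsberg permanent-versus-zero factor-closure argument,
`BIJL18PermanentZeroFactorClosureProofs.lean`). [cite: Burgisser2024Completeness, Thm. 3.2] -/
theorem kaltofenFactorBound_rat : KaltofenFactorBound ℚ :=
  kaltofenFactorBound_holds ℚ

end Main

end Literature.Computability.AlgebraicComplexity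

end
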